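import Literature.NumberTheory.ConnesConsani2023.ZetaCyclesSemilocalFormProofs
import Literature.NumberTheory.ConnesConsani2023.ZetaCyclesCoreConsequences
import Literature.NumberTheory.ConnesConsani2023.ZetaCyclesCoreTruncation
import Literature.NumberTheory.LFunctions.YoshidaPositivityThreshold
import Literature.NumberTheory.LFunctions.ZetaScrewLemma21Proofs
import Literature.NumberTheory.LFunctions.WeilWindowSimpleEven
import Literature.Analysis.Fourier.FourierCompactSupportAnalytic
import Mathlib.Topology.ContinuousMap.Bounded.ArzelaAscoli
import HarnessLib

/-!
# Yoshida's completed Weil form degenerates at the positivity threshold (Yoshida 1992, Thm. 2 `⟸`, k = ℚ)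

LINE 1 — LABEL: RH-FREE implications with explicit `¬ RiemannHypothesis` / `RiemannHypothesis`
hypotheses (cf. the `Suzuki2023_thm61`-type statements of this directory), assembled into an
RH-EQUIVALENT·DERIVED criterion PROVED AS AN EQUIVALENCE (`riemannHypothesis_iff_forall_completedWeilForm_nondegenerate`);
bears_on: B-C/B-P (LADDER-RH COLUMN 6 DBR) + W-C/W-P (the objects are the Weil column's). WHAT THIS IS NOT:
not a positivity result, not a statement that the form degenerates (that needs `¬RH`) nor that it is
positive definite (that needs `RH`), not evidence for either side of RH; an equivalence proved as an
equivalence fixes WHICH property of the completed form is RH and moves RH by nothing.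

## Source and statement

H. Yoshida, *On Hermitian forms attached to zeta functions*, in: Zeta Functions in Geometry (Tokyo
1990), Adv. Stud. Pure Math. **21** (1992) 281–325 [cite: Yoshida1992HermitianForms, Thm. 2 (p. 321)]
(held `paper:yoshida2018-hermitian-forms-attached-zeta-functions`):

> Theorem 2. The Riemann hypothesis for `ζ_k(s)` holds if and only if the hermitian form `( , )` on
> `K̂(a)` is non-degenerate for every `a > 0`.

Here `( , )` is Weil's hermitian form `(φ, ψ) = T_k(φ ∗ ψ̃)` and `K̂(a) = W ⊕ K̂_N(a)`, `K̂_N(a)` the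
COMPLETION of `K_N(a)` for the form (coercive over `L²`: `(φ, φ) ≥ µ‖φ‖²_{L²}` on `K_N(a)`, Lemma 3),
"canonically embedded as a subspace of `L²([−a, a])`" (pp. 282–283). The proof of `⟸` (p. 321): by
Prop. 6 (p. 320; tree `Yoshida1992_prop6`, `weilPositivityThreshold`) there is a threshold `a₀` with
`( , )` positive semi-definite on `K(a)` for `a ≤ a₀` and not for `a > a₀`, and "these facts immediately
imply that `( , )|W(a)` degenerates at `a = a₀`" — via the continuity in `a` of the matrix of the form on
the finite-dimensional complement `W(a)` (§7, Prop. 5, Lemma 9).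

This file proves, for `k = ℚ`, the CONTENT of that `⟸` half as a kernel theorem, in the `L²`-extension
language of A. Connes, C. Consani, *Spectral triples and ζ-cycles*, Enseign. Math. **69** (2023) §2
[cite: ConnesConsani2023, Prop. 2.1, Lemma 2.2, pp. 103–105], whose objects this directory already has
(cell C1/cc): the form domain `formDomain a = {ξ ∈ L², supp ξ ⊆ [−a,a], ‖ξ̂‖₁² < ∞}` (= Yoshida's
`K̂(a)` as a subspace of `L²[−a, a]`: functions of finite energy
`logSobolevEnergy ξ = ∫ |ξ̂(½+it)|²(1 + log(1+t²)) dt`), the extended form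
`semilocalWeilForm a ξ = E_{⌊e^{2a}⌋}(ξ)` on the domain (`weilFinitePrimeQuadratic`, `= Re Q(g)` on test
functions, `semilocalWeilForm_eq_re_weilQuadratic`) and `+∞` off it, lower bounded and lower
semicontinuous (`prop_2_1_holds`), continuous for the graph norm (`tendsto_weilFinitePrimeQuadratic_of_energy`),
with `C(a)` dense in the graph norm (the core machinery of `lemma_2_2_holds`).

* `completedWeilForm_degenerate_of_not_riemannHypothesis` — **if RH fails** then, at
  `a₀ = weilPositivityThreshold ≥ (log 3)/2`, the extended form is `≥ 0` on EVERY square-integrable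
  function supported in `[−a₀, a₀]` and there is `ξ₀ ∈ formDomain a₀` with `∫|ξ₀|² = 1` and
  `semilocalWeilForm a₀ ξ₀ = 0`: the completed form is positive semi-definite AND DEGENERATE (a non-zero
  null vector of a positive semi-definite hermitian form lies in its radical).
* `riemannHypothesis_or_completedWeilForm_degenerate` — the unconditional dichotomy.
* `riemannHypothesis_of_forall_completedWeilForm_nondegenerate` — Yoshida's Thm. 2 `⟸` (k = ℚ) as an
  RH-free implication: non-degeneracy of the completed form on every window (indeed only on windows where
  it is `≥ 0`) implies RH.
* `weilPositivityOn_iff_semilocalWeilForm_nonneg` — Weil positivity on the test functions of a window is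
  positivity of the `L²`-extended form on the window (density + graph-norm continuity).
* `completedWeilForm_posDef_of_riemannHypothesis` — **if RH holds** then on every window the completed
  form is `≥ 0` and its only null vector in `formDomain a` is `0` (Thm. 2 `⟹`, pp. 321–322: the zero side
  `Σ_ρ m(ρ)|η̂(ρ)|² ≤ Re Q(η)` under RH, passage to `ξ ∈ K̂(a)` by density, `ξ̂(ρ) = 0` at every
  non-trivial zero, `ξ̂` entire of exponential type ⇒ `ξ̂ ≡ 0` by the tree's `Suzuki2023_lemma21_holds`
  (Yoshida: "N(r) ≠ O(r)", Siegel), and `ξ = 0` a.e. by Plancherel).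
* `riemannHypothesis_iff_forall_completedWeilForm_nondegenerate`,
  `riemannHypothesis_iff_forall_completedWeilForm_posDef` — **Yoshida 1992 Thm. 2 for `k = ℚ` as a kernel
  RH-EQUIVALENCE** in the completed-space language: RH ⟺ for every window `a > 0` [on which the completed
  form is `≥ 0`] the completed form has no non-zero null vector in `K̂(a)`.
* `exists_semilocalWeilForm_ground_state`, `YoshidaCompletedForm.exists_ground_state` — **RH-free:
  GROUND STATES EXIST**: for every window `a > 0` the lower bound `formLowerBound a` of `QW_λ` (CC Cor. 2.4)
  is ATTAINED by a unit vector of `formDomain a` = E. Bombieri, Rend. Lincei (9) 11 (2000) §4 **Thm. 3**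
  ("the infimum of `T[f ∗ f̄*]` in the unit sphere of `L²(𝓔)` is attained", `𝓔 = [e^{−a}, e^a]`) by the
  printed road (minimising sequence, energy bound (4.4), compactness, strong `L²` convergence, lower
  semicontinuity) [cite: Bombieri2000Weil, §4 Thm. 3 (p. 196)]; and
  `YoshidaCompletedForm.formLowerBound_eq_weilGroundEnergy` — the infimum over the form domain equals the
  tree's ground energy `ε(a)` over test functions (`C_c^∞` is a form core, CC (2.15)–(2.16)), closing the
  remark in the docstring of `ConnesConsani2023.formLowerBound`.
* `formLowerBound_pos_of_riemannHypothesis`, `riemannHypothesis_iff_forall_formLowerBound_pos` — under RH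
  the bottom of the spectrum of `QW_λ` is STRICTLY positive on every window (attainment + positive
  definiteness), whence RH ⟺ `∀ a > 0, 0 < formLowerBound a`; this is the completed-space form of
  `0 < ε(a)` / "RH ⟺ `∀ a > 0, 0 < ε(a)`", which the summit tree has by a completion-free road
  (`SoloInformedNonDegenerate.lean`); `formLowerBound_threshold_eq_zero_of_not_riemannHypothesis`,
  `exists_negative_ground_state_of_threshold_lt` — under `¬RH` the bottom of the spectrum is `0` (attained)
  at `a₀` and `< 0` (attained) beyond it.
* `YoshidaCompletedForm.hasSum_zeroSide_radical`, `exists_zeroSide_null_relation_of_not_riemannHypothesis` —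
  **the radical is Weil-orthogonal to the window, on the zero side**: if the completed form is `≥ 0` on
  `[−a, a]` and `ξ₀ ∈ Dom` is a null vector, then `Σ_ρ m(ρ) ξ̂₀(ρ) conj ĥ(1−ρ̄) = 0` (absolutely convergent
  sum over the non-trivial zeros) for every test `h` supported in `[−a, a]` (sesquilinear expansion of
  `Q` on tests, hermitian symmetry from `weilQuadratic_im_holds`, `explicit_formula_holds` for `η_m ⋆ h̃`,
  uniform convergence of `η̂_m → ξ̂₀` on the strip); hence under `¬RH` a unit `ξ₀ ∈ K̂(a₀)` whose
  transform does not vanish at all zeros (`ae_eq_zero_of_weilMellin_eq_zero_on_zeros`, RH-free form of the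
  Part E uniqueness) but whose zero-values annihilate all of `C(a₀)` — the completed-space relation behind
  Suzuki's null series (J. Lond. Math. Soc. 108 (2023) Thm. 6.1, §6.2), which is this identity integrated
  twice against the kernel `(1 − e^{−(ρ−½)t})/(ρ−½)²`.

## Road (all inputs are PROVED tree theorems; this is NOT Yoshida's §7 matrix-continuity argument)

A. `C(a)` is dense in `formDomain a` for the energy (dilation `exists_dilate_logSobolevEnergy_sub_lt` +
   mollification `exists_mem_C_logSobolevEnergy_sub_lt`, the steps (2.17)–(2.18) of CC's Lemma 2.2); hence
   `WeilPositivityOn a ⇒ E_N ≥ 0` on `formDomain a` and `E_N = E_M` there for `N, M ≥ ⌊e^{2a}⌋`.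
B. Energy coercivity `‖ξ̂‖₁² ≤ 4π E_N(ξ) + C‖ξ‖₂²` (`∂_tθ = ½log|t| + O(1)`:
   `exists_logWeight_le_reDigammaQuarter_sub`; bounded prime ripple; bounded polar term).
C. A RELLICH LEMMA for the log-energy (`exists_subseq_tendsto_of_energy_le`): window-supported sequences
   bounded in `L²` and in energy have `L²`-convergent subsequences — uniform tails
   `∫|ξ − ξ ⋆ φ_k|² ≤ (R r_k)²‖ξ‖² + 2‖ξ̂‖₁²/(π(1+log(1+R²)))` (Plancherel, `|1 − φ̂_k(½+it)| ≤ |t| r_k`),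
   Arzelà–Ascoli (Mathlib `BoundedContinuousFunction.arzela_ascoli`) for the equicontinuous mollified family
   on the compact window, total boundedness in the complete space `Lp ℂ 2`. This is the compactness of the
   embedding `K̂(a) ↪ L²[−a, a]` behind Yoshida's Lemma 3 / CC's compact-resolvent picture.
E. Under `RH` (section E): `Σ_{ρ∈Z_T} m(ρ)|η̂(ρ)|² ≤ Re Q(η)` for test `η`
   (`explicit_formula_holds`, `weilMellin_weilQuadratic_of_re_eq`, monotone partial sums), transforms of
   window functions are entire (`Literature.Analysis.Fourier.differentiable_fourierLaplace`) with
   `|ξ̂(s)| ≤ e^{|Re s−½|a}∫|ξ|`, zeros via `riemannXi_eq_zero_iff_holds` / `im_ne_zero_of_riemannZeta_eq_zero`.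
D. Under `¬RH`: unit test vectors `u_n` supported in `[−a_n, a_n]`, `a_n ↓ a₀`, with `E(u_n) < 0`
   (Prop. 6 (2)) have bounded energy (B); a subsequence converges in `L²` (C) to `ξ` with `∫|ξ|² = 1`,
   `ξ = 0` a.e. off `[−a₀, a₀]`, finite energy (Fatou, `logSobolevEnergy_le_liminf_of_tendsto_integral_norm`);
   `E(ξ) ≤ 0` by lower semicontinuity (`semilocalWeilForm_le_liminf`) and `E(ξ) ≥ 0` by Weil positivity
   AT `a₀` (Prop. 6 (1), passed to the completion by A); so `E(ξ) = 0`.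
F. Ground states (RH-free): a minimising sequence for `formLowerBound a` has bounded energy (B), an
   `L²`-convergent subsequence (C), and its limit is a unit vector of the domain minimising the form (lower
   semicontinuity) — Bombieri's proof of his Thm. 3, with (C) in place of the Taylor-coefficient diagonal
   argument of p. 196; `formLowerBound a = ε(a)` by (A) and homogeneity of `Q`.
G. Radical (zero side): for a null vector `ξ₀` of the PSD completed form and a window test `h`,
   `0 ≤ Re Q(η_m + c h) = Re Q(η_m) + 2 Re(c̄ W(η_m ⋆ h̃)) + |c|² Re Q(h)` with `η_m → ξ₀` in the graph norm;
   `W(η_m ⋆ h̃) = Σ_ρ m(ρ) η̂_m(ρ) conj ĥ(1−ρ̄)` (explicit formula) tends to the same sum for `ξ₀`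
   (`|η̂_m − ξ̂₀| ≤ e^{a/2}‖η_m − ξ₀‖₁` on the strip, summable majorant `Σ m(ρ)|ĥ(1−ρ̄)|`), and
   `Re Q(η_m) → E(ξ₀) = 0`; the limit inequality for all `c ∈ ℂ` forces the sum to vanish.

## Why this file exists (record of the dbl cell, 2026-08-26)

M. Suzuki, J. Lond. Math. Soc. 108 (2023), Thm. 1.4 [cite: Suzuki2023, Thm. 1.4 and §5.2] (tree fact
`Suzuki2023_thm14`, `⟹` proved) asserts the analogous criterion with degeneracy ON `L²(−a, a)` in the
variable `φ = ψ′` (Suzuki's `⟨Dψ, Dψ⟩_{G_g} = ⟨ψ, ψ⟩_W`, Prop. 3.1), i.e. a radical vector with `ψ₀′ ∈ L²`,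
which is stronger than Yoshida's Thm. 2 (`ψ₀ ∈ K̂(a₀) ⊂ L²`) and than what this file proves; its printed
proof (§5.2) follows Yoshida's strategy. The cell records that road as not formalized (memo
`MEMO-Su23-thm14-converse.md` of seat rh-crit-dbl-t8); the present theorem is the completed-space statement
that the compactness road yields. Nothing here bears on the truth of the Riemann hypothesis.

## References
* H. Yoshida, Adv. Stud. Pure Math. 21 (1992), Thm. 2 p. 321, Prop. 6 p. 320, §0 pp. 282–283, Lemma 3.
  [Yoshida1992HermitianForms]
* A. Connes, C. Consani, Enseign. Math. 69 (2023), §2.1.2, Prop. 2.1, Lemma 2.2, pp. 103–105. [ConnesConsani2023]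
* M. Suzuki, J. Lond. Math. Soc. (2) 108 (2023), Thm. 1.4, §5.2; Thm. 6.1, §6.2 (p. 16); Lemma 2.1. [Suzuki2023]
* E. Bombieri, *Remarks on Weil's quadratic functional in the theory of prime numbers I*, Rend. Lincei (9)
  Mat. Appl. 11 (2000) 183–233, §4 Problems 1–2 (p. 194), Thm. 3 (p. 196) (held copy
  `paper:galaxy-pdf-4005501466549090220`, PDF pp. 12–16). [Bombieri2000Weil]
-/

noncomputable section

open Complex Filter Set MeasureTheory
open scoped Real Topology ENNReal ComplexConjugate

namespace Literature.NumberTheory.LFunctions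

open Literature.NumberTheory.ConnesConsani2023
open Literature.Analysis.SpecialFunctions (reDigammaQuarter reDigammaQuarter_zero_le
  continuous_reDigammaQuarter)

namespace YoshidaCompletedForm

variable {a : ℝ}

/-! ## A. Test functions are dense in the form domain for the energy (graph) norm -/

/-- Every `ξ ∈ Dom(QW_λ)` on the window `[−a, a]` is the energy-limit of test functions supported in
`[−a, a]`: dilation (2.17) then mollification (2.18) of the printed proof of Lemma 2.2.
[cite: ConnesConsani2023, proof of Lemma 2.2, eqs. (2.17)–(2.18), p. 105] -/
theorem exists_seq_C_tendsto_energy (ha : 0 < a) {ξ : ℝ → ℂ} (hξ : ξ ∈ formDomain a) :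
    ∃ η : ℕ → ℝ → ℂ, (∀ m, η m ∈ Yoshida1992.C a) ∧
      Tendsto (fun m ↦ logSobolevEnergy (fun x ↦ η m x - ξ x)) atTop (𝓝 0) := by
  -- for every `m` an element of `C(a)` within energy `1/(m+1)` of `ξ`
  have key : ∀ m : ℕ, ∃ η : ℝ → ℂ, η ∈ Yoshida1992.C a ∧
      logSobolevEnergy (fun x ↦ η x - ξ x) ≤ ENNReal.ofReal (1 / ((m : ℝ) + 1)) := by
    intro m
    set δ : ℝ≥0∞ := ENNReal.ofReal (1 / (8 * ((m : ℝ) + 1))) with hδ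
    have hδpos : 0 < δ := ENNReal.ofReal_pos.2 (by positivity)
    -- (2.17) dilation
    obtain ⟨ρ, hρ1, hρ2, hdil⟩ := exists_dilate_logSobolevEnergy_sub_lt ha hξ hδpos
    have hρ0 : 0 < ρ := by linarith
    set ξ₁ : ℝ → ℂ := fun x ↦ (ρ : ℂ) * ξ (ρ * x) with hξ₁
    have hξ₁m : MemLp ξ₁ 2 volume := memLp_dilate hρ0 hξ.1
    have hξ₁s : Function.support ξ₁ ⊆ Icc (-(a / ρ)) (a / ρ) := support_dilate_subset hρ0 hξ.2.1
    have haρ : a / ρ < a := by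
      rw [div_lt_iff₀ hρ0]; nlinarith
    have hξ₁s' : Function.support ξ₁ ⊆ Icc (-a) a :=
      hξ₁s.trans (Icc_subset_Icc (by linarith) haρ.le)
    -- energy of `ξ₁` is finite
    have hξ₁E : logSobolevEnergy ξ₁ < ∞ := by
      have h1 : logSobolevEnergy (ξ - fun x ↦ ξ x - ξ₁ x) ≤
          2 * logSobolevEnergy ξ + 2 * logSobolevEnergy (fun x ↦ ξ x - ξ₁ x) :=
        logSobolevEnergy_sub_le hξ.1 hξ.2.1 (hξ.1.sub hξ₁m)
          (support_sub_subset_window hξ.2.1 hξ₁s')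
      have e : (ξ - fun x ↦ ξ x - ξ₁ x) = ξ₁ := by funext x; simp
      rw [e] at h1
      have h2 : logSobolevEnergy (fun x ↦ ξ x - ξ₁ x) < ∞ := by
        have : (fun x ↦ ξ x - ξ₁ x) = ξ - ξ₁ := rfl
        rw [this]; exact hdil.trans ENNReal.ofReal_lt_top
      refine h1.trans_lt ?_
      have hξE := hξ.2.2
      exact ENNReal.add_lt_top.2 ⟨ENNReal.mul_lt_top (by norm_num) hξE,
        ENNReal.mul_lt_top (by norm_num) h2⟩
    -- (2.18) mollification inside `C(a)`
    obtain ⟨η, hηC, hη⟩ := exists_mem_C_logSobolevEnergy_sub_lt haρ hξ₁m hξ₁s hξ₁E hδpos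
    refine ⟨η, hηC, ?_⟩
    obtain ⟨hηm, hηs⟩ := memLp_and_support_of_mem_C hηC
    -- quasi-triangle inequality `‖(ξ−ξ₁) − (η−ξ₁)‖₁² ≤ 2‖ξ−ξ₁‖₁² + 2‖η−ξ₁‖₁²`
    have hηs' : Function.support η ⊆ Icc (-a) a := hηs
    have htri := logSobolevEnergy_sub_le (a := a) (hξ.1.sub hξ₁m)
      (support_sub_subset_window hξ.2.1 hξ₁s') (hηm.sub hξ₁m)
      (support_sub_subset_window hηs' hξ₁s')
    have e1 : (ξ - ξ₁ - (η - ξ₁)) = ξ - η := by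
      funext x; simp only [Pi.sub_apply]; ring
    rw [e1] at htri
    have e2 : logSobolevEnergy (η - ξ₁) = logSobolevEnergy (ξ₁ - η) :=
      logSobolevEnergy_sub_comm ξ₁ η
    rw [e2] at htri
    rw [logSobolevEnergy_sub_comm]
    refine htri.trans ?_
    have h4 : 2 * logSobolevEnergy (ξ - ξ₁) + 2 * logSobolevEnergy (ξ₁ - η) ≤ 2 * δ + 2 * δ := by
      gcongr
    refine h4.trans ?_
    rw [hδ, ← ENNReal.ofReal_ofNat 2, ← ENNReal.ofReal_mul (by norm_num), ← ENNReal.ofReal_add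
      (by positivity) (by positivity)]
    refine ENNReal.ofReal_le_ofReal ?_
    have : (0 : ℝ) < (m : ℝ) + 1 := by positivity
    field_simp
    norm_num
  choose η hηC hηE using key
  refine ⟨η, hηC, ?_⟩
  refine ENNReal.tendsto_nhds_zero.2 fun ε hε ↦ ?_
  rcases eq_or_ne ε ∞ with h | h
  · exact Eventually.of_forall fun m ↦ h ▸ le_top
  have hε' : 0 < ε.toReal := ENNReal.toReal_pos hε.ne' h
  have ht : Tendsto (fun m : ℕ ↦ 1 / ((m : ℝ) + 1)) atTop (𝓝 0) :=
    tendsto_one_div_add_atTop_nhds_zero_nat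
  filter_upwards [ht.eventually (gt_mem_nhds hε')] with m hm
  refine (hηE m).trans ?_
  rw [← ENNReal.ofReal_toReal h]
  exact ENNReal.ofReal_le_ofReal hm.le

/-- **Weil positivity on the window passes to the completed space**: if `Re Q(g) ≥ 0` for all test
functions supported in `[−a, a]`, then the `L²`-extended form is `≥ 0` on every square-integrable
function supported in the window (on `Dom(QW_λ)` by density of `C(a)` in the graph norm and continuity of
`E_N` for it; off the domain the form is `+∞`). [cite: Yoshida1992HermitianForms, §0 p. 282 («We can extend ( , ) to K(a)» and the completion K̂_N(a)); ConnesConsani2023, Prop. 2.1 and Lemma 2.2, pp. 103–105] -/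
theorem weilFinitePrimeQuadratic_nonneg_of_weilPositivityOn (ha : 0 < a) (hpos : WeilPositivityOn a)
    {ξ : ℝ → ℂ} (hξ : ξ ∈ formDomain a) {N : ℕ} (hN : primeCutoff a ≤ N) :
    0 ≤ weilFinitePrimeQuadratic N ξ := by
  obtain ⟨η, hηC, hηE⟩ := exists_seq_C_tendsto_energy ha hξ
  have hηD : ∀ m, η m ∈ formDomain a := fun m ↦
    mem_formDomain_of_isWeilTest (Yoshida1992.mem_C.1 (hηC m)).1 (Yoshida1992.mem_C.1 (hηC m)).2
  have hlim := tendsto_weilFinitePrimeQuadratic_of_energy ha hξ hηD hηE N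
  refine ge_of_tendsto' hlim fun m ↦ ?_
  obtain ⟨hηt, hηs⟩ := Yoshida1992.mem_C.1 (hηC m)
  -- on test functions `E_N = Re Q ≥ 0`
  have hwin : tsupport (η m) ⊆ Icc (-(Real.log ((N : ℝ) + 1) / 2)) (Real.log ((N : ℝ) + 1) / 2) := by
    have h1 := le_log_primeCutoff_add_one_div_two a
    have h2 : Real.log ((primeCutoff a : ℝ) + 1) ≤ Real.log ((N : ℝ) + 1) :=
      Real.log_le_log (by positivity) (by exact_mod_cast Nat.add_le_add_right hN 1)
    exact hηs.trans (Icc_subset_Icc (by linarith) (by linarith))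
  have hQ := weilQuadratic_eq_weilFinitePrimeQuadratic hηt N hwin
  have hre := hpos (η m) hηt hηs
  rw [hQ, Complex.ofReal_re] at hre
  exact hre

/-- The `EReal`-valued extended form `QW_λ` is `≥ 0` on all window-supported `L²` functions as soon as
Weil positivity holds on the test functions of the window. [cite: ConnesConsani2023, Prop. 2.1 (the L²-extension), p. 103; Yoshida1992HermitianForms, §0 p. 282] -/
theorem semilocalWeilForm_nonneg_of_weilPositivityOn (ha : 0 < a) (hpos : WeilPositivityOn a)
    {ξ : ℝ → ℂ} (hξm : MemLp ξ 2 volume) (hξs : Function.support ξ ⊆ Icc (-a) a) :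
    0 ≤ semilocalWeilForm a ξ := by
  by_cases hE : logSobolevEnergy ξ < ∞
  · rw [semilocalWeilForm_of_lt_top hE]
    exact_mod_cast weilFinitePrimeQuadratic_nonneg_of_weilPositivityOn ha hpos ⟨hξm, hξs, hE⟩ le_rfl
  · rw [semilocalWeilForm_of_not_lt_top hE]; exact le_top

/-- Conversely (trivially), positivity of the extended form on the window gives Weil positivity on its
test functions. [cite: ConnesConsani2023, Prop. 2.1, p. 103] -/
theorem weilPositivityOn_of_semilocalWeilForm_nonneg
    (h : ∀ ξ : ℝ → ℂ, MemLp ξ 2 volume → Function.support ξ ⊆ Icc (-a) a → 0 ≤ semilocalWeilForm a ξ) :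
    WeilPositivityOn a := by
  intro g hg hgs
  have h1 := h g (hg.1.continuous.memLp_of_hasCompactSupport hg.2) ((subset_tsupport g).trans hgs)
  rw [semilocalWeilForm_eq_re_weilQuadratic hg hgs] at h1
  exact_mod_cast h1

/-- **Independence of the cutoff beyond the support**: for `ξ ∈ Dom` on the window `[−a, a]` the value
`E_N(ξ)` is the same for all `N ≥ ⌊e^{2a}⌋` (the extra prime terms see only `|x − y| = log n > 2a`).
Via density of test functions, for which both equal `Re Q`. [cite: ConnesConsani2023, Prop. 2.1 eq. (2.11) (the range 1 < n ≤ λ²), p. 103] -/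
theorem weilFinitePrimeQuadratic_eq_of_le (ha : 0 < a) {ξ : ℝ → ℂ} (hξ : ξ ∈ formDomain a) {N M : ℕ}
    (hN : primeCutoff a ≤ N) (hM : primeCutoff a ≤ M) :
    weilFinitePrimeQuadratic N ξ = weilFinitePrimeQuadratic M ξ := by
  obtain ⟨η, hηC, hηE⟩ := exists_seq_C_tendsto_energy ha hξ
  have hηD : ∀ m, η m ∈ formDomain a := fun m ↦
    mem_formDomain_of_isWeilTest (Yoshida1992.mem_C.1 (hηC m)).1 (Yoshida1992.mem_C.1 (hηC m)).2
  have hN' := tendsto_weilFinitePrimeQuadratic_of_energy ha hξ hηD hηE N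
  have hM' := tendsto_weilFinitePrimeQuadratic_of_energy ha hξ hηD hηE M
  have hwin : ∀ {K : ℕ}, primeCutoff a ≤ K → ∀ m,
      tsupport (η m) ⊆ Icc (-(Real.log ((K : ℝ) + 1) / 2)) (Real.log ((K : ℝ) + 1) / 2) := by
    intro K hK m
    have h1 := le_log_primeCutoff_add_one_div_two a
    have h2 : Real.log ((primeCutoff a : ℝ) + 1) ≤ Real.log ((K : ℝ) + 1) :=
      Real.log_le_log (by positivity) (by exact_mod_cast Nat.add_le_add_right hK 1)
    exact (Yoshida1992.mem_C.1 (hηC m)).2.trans (Icc_subset_Icc (by linarith) (by linarith))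
  have heq : (fun m ↦ weilFinitePrimeQuadratic N (η m)) = fun m ↦ weilFinitePrimeQuadratic M (η m) := by
    funext m
    have hηt := (Yoshida1992.mem_C.1 (hηC m)).1
    have e1 := weilQuadratic_eq_weilFinitePrimeQuadratic hηt N (hwin hN m)
    have e2 := weilQuadratic_eq_weilFinitePrimeQuadratic hηt M (hwin hM m)
    exact_mod_cast e1.symm.trans e2
  rw [heq] at hN'
  exact tendsto_nhds_unique hN' hM'



variable {a : ℝ}

/-! ## B. Energy coercivity of the finite-prime form -/

/-- The log weight `1 + log(1+t²)` is at least `1`. [folklore] -/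
private theorem one_le_logW (t : ℝ) : 1 ≤ 1 + Real.log (1 + t ^ 2) := by
  have := Real.log_nonneg (show (1 : ℝ) ≤ 1 + t ^ 2 by nlinarith [sq_nonneg t])
  linarith

/-- On the form domain the energy is the genuine integral `∫ |ξ̂(½+it)|² (1 + log(1+t²)) dt`, and the
integrand is integrable. [cite: ConnesConsani2023, proof of Lemma 2.2, the norm ‖ξ̂‖₁² (arXiv chunk p0007:L43), p. 105] -/
theorem integrable_energyIntegrand {ξ : ℝ → ℂ} (hξ : ξ ∈ formDomain a) :
    Integrable (fun t : ℝ ↦ ‖weilMellin ξ (1 / 2 + t * I)‖ ^ 2 * (1 + Real.log (1 + t ^ 2))) ∧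
      (logSobolevEnergy ξ).toReal =
        ∫ t : ℝ, ‖weilMellin ξ (1 / 2 + t * I)‖ ^ 2 * (1 + Real.log (1 + t ^ 2)) := by
  have hint : Integrable ξ := integrable_of_memLp_window hξ.1 hξ.2.1
  set f : ℝ → ℝ := fun t ↦ ‖weilMellin ξ (1 / 2 + t * I)‖ ^ 2 * (1 + Real.log (1 + t ^ 2)) with hf
  have hf0 : ∀ t, 0 ≤ f t := fun t ↦ mul_nonneg (sq_nonneg _) (zero_le_one.trans (one_le_logW t))
  have hlogW : Continuous fun t : ℝ ↦ 1 + Real.log (1 + t ^ 2) := by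
    refine continuous_const.add (Continuous.log (by fun_prop) fun t ↦ ?_)
    have := sq_nonneg t
    positivity
  have hfc : Continuous f :=
    (((continuous_weilMellin_half_line_of_integrable hint).norm).pow 2).mul hlogW
  have hE : logSobolevEnergy ξ = ∫⁻ t, ENNReal.ofReal (f t) := rfl
  have hfin : ∫⁻ t, ENNReal.ofReal (f t) < ∞ := hE ▸ hξ.2.2
  have hI : Integrable f := by
    refine ⟨hfc.aestronglyMeasurable, ?_⟩
    rw [hasFiniteIntegral_iff_enorm]
    have e : (fun t ↦ ‖f t‖ₑ) = fun t ↦ ENNReal.ofReal (f t) := by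
      funext t; rw [Real.enorm_eq_ofReal (hf0 t)]
    rw [e]; exact hfin
  refine ⟨hI, ?_⟩
  rw [hE, ← ofReal_integral_eq_lintegral_ofReal hI (Eventually.of_forall hf0),
    ENNReal.toReal_ofReal (integral_nonneg hf0)]

/-- **Energy coercivity**: on the window `[−a, a]` (`a > 0`) and for every cutoff `N` there is `C` with
`‖ξ̂‖₁² ≤ 4π E_N(ξ) + C ‖ξ‖₂²` for every `ξ ∈ Dom(QW_λ)` — the archimedean weight dominates half the
log weight (`∂_tθ(t) = ½ log|t| + O(1)`), the prime ripple and the polar term are `L²`-bounded.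
[cite: ConnesConsani2023, proof of Prop. 2.1 and of Lemma 2.2 (Dom(QW_λ) = {Q_∞ < ∞}, ∂θ ~ ½ log|t|), pp. 103–105] -/
theorem exists_energy_le (ha : 0 < a) (N : ℕ) :
    ∃ C : ℝ, ∀ ξ : ℝ → ℂ, ξ ∈ formDomain a →
      (logSobolevEnergy ξ).toReal ≤
        4 * π * weilFinitePrimeQuadratic N ξ + C * ∫ x, ‖ξ x‖ ^ 2 := by
  obtain ⟨K, hK⟩ := exists_logWeight_le_reDigammaQuarter_sub
  obtain ⟨K', hK'pos, hK'⟩ := exists_reDigammaQuarter_sub_le_logWeight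
  set R : ℝ := ∑ n ∈ Finset.range (N + 1), (ArithmeticFunction.vonMangoldt n : ℝ) / Real.sqrt n * 2
    with hR
  -- `w_N(t) ≥ logW(t)/2 + c₀`
  set c₀ : ℝ := reDigammaQuarter 0 - R - K / 2 with hc₀
  have hw : ∀ t, (1 + Real.log (1 + t ^ 2)) / 2 + c₀ ≤ weilFinitePrimeWeight N t := by
    intro t
    have h1 := hK t
    have h2 := (abs_le.1 (abs_weilPrimeRipple_le N t)).2
    simp only [weilFinitePrimeWeight, hc₀]
    linarith
  -- `|w_N(t)| ≤ K₂ logW(t)`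
  have hwabs : ∀ t, |weilFinitePrimeWeight N t| ≤
      (|reDigammaQuarter 0| + R + K') * (1 + Real.log (1 + t ^ 2)) := by
    intro t
    have h1 := hK' t
    have h2 := abs_weilPrimeRipple_le N t
    have h3 := reDigammaQuarter_zero_le t
    have hl := one_le_logW t
    simp only [weilFinitePrimeWeight]
    rw [abs_le]
    constructor
    · have : -(|reDigammaQuarter 0| + R + K') * (1 + Real.log (1 + t ^ 2)) ≤
          -(|reDigammaQuarter 0| + R) := by
        have hRnn : 0 ≤ R := Finset.sum_nonneg fun n _ ↦ mul_nonneg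
          (div_nonneg ArithmeticFunction.vonMangoldt_nonneg (Real.sqrt_nonneg _)) zero_le_two
        nlinarith [abs_nonneg (reDigammaQuarter 0)]
      nlinarith [neg_abs_le (reDigammaQuarter 0), (abs_le.1 h2).2]
    · nlinarith [le_abs_self (reDigammaQuarter 0), (abs_le.1 h2).1, abs_nonneg (reDigammaQuarter 0),
        (show 0 ≤ R from Finset.sum_nonneg fun n _ ↦ mul_nonneg
          (div_nonneg ArithmeticFunction.vonMangoldt_nonneg (Real.sqrt_nonneg _)) zero_le_two)]
  refine ⟨4 * π * (4 * a * Real.exp a + |Real.log π| + |c₀|), fun ξ hξ ↦ ?_⟩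
  obtain ⟨hI, hEeq⟩ := integrable_energyIntegrand hξ
  have hint : Integrable ξ := integrable_of_memLp_window hξ.1 hξ.2.1
  have hPl := integrable_norm_sq_weilMellin_half_line_of_memLp hint hξ.1
  have hPlanch := integral_norm_sq_weilMellin_half_line_of_memLp hint hξ.1
  set n2 : ℝ := ∫ x, ‖ξ x‖ ^ 2 with hn2
  have hn2nn : 0 ≤ n2 := integral_nonneg fun _ ↦ by positivity
  set F : ℝ → ℝ := fun t ↦ ‖weilMellin ξ (1 / 2 + t * I)‖ ^ 2 with hF
  -- integrability of `|ξ̂|² w_N` by domination with the energy integrand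
  have hJint : Integrable (fun t ↦ F t * weilFinitePrimeWeight N t) := by
    refine (hI.const_mul (|reDigammaQuarter 0| + R + K')).mono' ?_ ?_
    · exact ((((continuous_weilMellin_half_line_of_integrable hint).norm).pow 2).mul
        ((continuous_reDigammaQuarter).sub (continuous_weilPrimeRipple N))).aestronglyMeasurable
    · refine Eventually.of_forall fun t ↦ ?_
      rw [Real.norm_eq_abs, abs_mul, abs_of_nonneg (sq_nonneg _)]
      calc F t * |weilFinitePrimeWeight N t|
          ≤ F t * ((|reDigammaQuarter 0| + R + K') * (1 + Real.log (1 + t ^ 2))) :=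
            mul_le_mul_of_nonneg_left (hwabs t) (sq_nonneg _)
        _ = (|reDigammaQuarter 0| + R + K') * (F t * (1 + Real.log (1 + t ^ 2))) := by ring
  -- the lower bound for `J = ∫ F w_N`
  have hJ : (1 / 2) * (logSobolevEnergy ξ).toReal + c₀ * (2 * π * n2) ≤
      ∫ t, F t * weilFinitePrimeWeight N t := by
    rw [hEeq, ← hPlanch, ← integral_const_mul, ← integral_const_mul, ← integral_add (hI.const_mul _)
      (hPl.const_mul _)]
    refine integral_mono ((hI.const_mul _).add (hPl.const_mul _)) hJint fun t ↦ ?_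
    have := hw t
    have hFt : 0 ≤ F t := sq_nonneg _
    show 1 / 2 * (F t * (1 + Real.log (1 + t ^ 2))) + c₀ * F t ≤ F t * weilFinitePrimeWeight N t
    nlinarith
  have hpol := (abs_le.1 (abs_polar_le hξ.1 hξ.2.1 ha)).1
  have hlog : -(|Real.log π| * n2) ≤ -(Real.log π * n2) := by
    nlinarith [le_abs_self (Real.log π)]
  have hc₀n : -(|c₀| * n2) ≤ c₀ * n2 := by nlinarith [neg_abs_le c₀]
  have hEt : 0 ≤ (logSobolevEnergy ξ).toReal := ENNReal.toReal_nonneg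
  unfold weilFinitePrimeQuadratic
  have hw2 : weilNorm2Sq ξ = n2 := rfl
  rw [hw2]
  have hπ : 0 < π := Real.pi_pos
  have key : 1 / (2 * π) * ((1 / 2) * (logSobolevEnergy ξ).toReal + c₀ * (2 * π * n2)) ≤
      1 / (2 * π) * ∫ t, F t * weilFinitePrimeWeight N t :=
    mul_le_mul_of_nonneg_left hJ (by positivity)
  have e1 : 1 / (2 * π) * ((1 / 2) * (logSobolevEnergy ξ).toReal + c₀ * (2 * π * n2)) =
      (logSobolevEnergy ξ).toReal / (4 * π) + c₀ * n2 := by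
    field_simp; ring
  rw [e1] at key
  have e2 : (logSobolevEnergy ξ).toReal = 4 * π * ((logSobolevEnergy ξ).toReal / (4 * π)) := by
    field_simp
  rw [e2]
  nlinarith [abs_nonneg c₀, abs_nonneg (Real.log π), mul_nonneg (abs_nonneg c₀) hn2nn,
    mul_nonneg (abs_nonneg (Real.log π)) hn2nn, Real.exp_pos a]


/-! ## C. A Rellich lemma for the log-energy on a window -/

section Rellich

open WeilContinuous

/-- `|1 − φ̂_k(½+it)| ≤ |t| · r_k` for the normalised bump `φ_k` of radius `r_k = 1/(k+1)`
(`1 − φ̂_k(½+it) = ∫ φ_k(x)(1 − e^{itx}) dx` and `|1 − e^{itx}| ≤ |t||x|`): the quantitative form of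
`φ̂_n → 1` used in the mollification step (2.18). [cite: ConnesConsani2023, proof of Lemma 2.2 eq. (2.18) (φ̂(s/n) → 1; arXiv chunk p0007:L48–L50), p. 105] -/
theorem norm_one_sub_weilMellin_moll_le (k : ℕ) (t : ℝ) :
    ‖1 - weilMellin (moll k) (1 / 2 + t * I)‖ ≤ |t| * (bump k).rOut := by
  have hint : Integrable (moll k) :=
    (continuous_moll k).integrable_of_hasCompactSupport (hasCompactSupport_moll k)
  have hint2 : Integrable fun x : ℝ ↦ moll k x * cexp ((1 / 2 + t * I - 1 / 2) * x) :=
    ((continuous_moll k).mul (by fun_prop)).integrable_of_hasCompactSupport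
      ((hasCompactSupport_moll k).mul_right)
  have e1 : (1 : ℂ) - weilMellin (moll k) (1 / 2 + t * I) =
      ∫ x : ℝ, moll k x * (1 - cexp ((1 / 2 + t * I - 1 / 2) * x)) := by
    have e : (fun x : ℝ ↦ moll k x * (1 - cexp ((1 / 2 + t * I - 1 / 2) * x))) =
        fun x ↦ moll k x - moll k x * cexp ((1 / 2 + t * I - 1 / 2) * x) := by
      funext x; ring
    rw [e, integral_sub hint hint2, integral_moll]
    rfl
  rw [e1]
  calc ‖∫ x : ℝ, moll k x * (1 - cexp ((1 / 2 + t * I - 1 / 2) * x))‖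
      ≤ ∫ x : ℝ, ‖moll k x * (1 - cexp ((1 / 2 + t * I - 1 / 2) * x))‖ :=
        norm_integral_le_integral_norm _
    _ ≤ ∫ x : ℝ, ‖moll k x‖ * (|t| * (bump k).rOut) := by
        refine integral_mono_of_nonneg (Eventually.of_forall fun _ ↦ norm_nonneg _)
          ((integrable_norm_moll k).mul_const _) (Eventually.of_forall fun x ↦ ?_)
        dsimp only
        rw [norm_mul]
        rcases le_or_gt (bump k).rOut |x| with hx | hx
        · rw [moll_eq_zero hx]; simp
        · refine mul_le_mul_of_nonneg_left ?_ (norm_nonneg _)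
          have e : (1 / 2 + (t : ℂ) * I - 1 / 2) * (x : ℂ) = I * ((t * x : ℝ) : ℂ) := by
            push_cast; ring
          rw [e, norm_sub_rev]
          calc ‖cexp (I * ((t * x : ℝ) : ℂ)) - 1‖ ≤ ‖t * x‖ := Real.norm_exp_I_mul_ofReal_sub_one_le
            _ = |t| * |x| := by rw [Real.norm_eq_abs, abs_mul]
            _ ≤ |t| * (bump k).rOut := mul_le_mul_of_nonneg_left hx.le (abs_nonneg t)
    _ = |t| * (bump k).rOut := by rw [integral_mul_const, integral_norm_moll, one_mul]

variable (a) in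
/-- The mollification `ξ ⋆ φ_k` of a window function: a test function supported in `[−(a+1), a+1]`.
[cite: ConnesConsani2023, proof of Lemma 2.2 (ξ₂ = φ ⋆ ξ₁ is smooth with support near the window; arXiv chunk p0007:L46–L48), p. 105] -/
theorem isWeilTest_weilConv_moll_window {ξ : ℝ → ℂ} (hξm : MemLp ξ 2 volume)
    (hξs : Function.support ξ ⊆ Icc (-a) a) (k : ℕ) :
    IsWeilTest (weilConv ξ (moll k)) ∧
      tsupport (weilConv ξ (moll k)) ⊆ Icc (-(a + 1)) (a + 1) := by
  have hint : Integrable ξ := integrable_of_memLp_window hξm hξs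
  have hcs : HasCompactSupport ξ := HasCompactSupport.of_support_subset_isCompact isCompact_Icc hξs
  have hts : tsupport ξ ⊆ Icc (-a) a := closure_minimal hξs isClosed_Icc
  refine ⟨?_, ?_⟩
  · rw [weilConv_eq_convolution_real]
    exact ⟨(hasCompactSupport_moll k).contDiff_convolution_right (ContinuousLinearMap.mul ℝ ℂ)
        hint.locallyIntegrable (contDiff_moll k),
      hcs.convolution (L := ContinuousLinearMap.mul ℝ ℂ) (hasCompactSupport_moll k)⟩
  · refine (tsupport_weilConv_subset hcs).trans ?_
    rintro x ⟨u, hu, v, hv, rfl⟩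
    have hu' := hts hu
    have hv' := WeilSquareMollifier.tsupport_moll_subset k hv
    have hr := bump_rOut_le_one k
    simp only [mem_Icc] at hu' hv' ⊢
    constructor <;> linarith [hu'.1, hu'.2, hv'.1, hv'.2]

/-- **Uniform `L²` tail estimate**: for a window function `ξ` of finite energy and the mollifier `φ_k`,
`∫|ξ − ξ ⋆ φ_k|² ≤ (R r_k)² ∫|ξ|² + 2‖ξ̂‖₁²/(π (1 + log(1+R²)))` for every `R ≥ 0` — Plancherel,
`(ξ − ξ ⋆ φ_k)^ = ξ̂ (1 − φ̂_k)`, `|1 − φ̂_k(½+it)| ≤ min(2, |t| r_k)`, and the log weight beyond `|t| > R`.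
This is the equi-smallness of tails that makes energy-bounded sets relatively compact.
[cite: ConnesConsani2023, proof of Lemma 2.2 eq. (2.18) (η̂_n = φ̂_n ξ̂₁, |φ̂| ≤ 1; arXiv chunk p0007:L48–L50), p. 105] -/
theorem integral_norm_sq_sub_weilConv_moll_le {ξ : ℝ → ℂ} (hξ : ξ ∈ formDomain a) (k : ℕ)
    {R : ℝ} (hR : 0 ≤ R) :
    ∫ x, ‖ξ x - weilConv ξ (moll k) x‖ ^ 2 ≤
      (R * (bump k).rOut) ^ 2 * (∫ x, ‖ξ x‖ ^ 2) +
        2 / (π * (1 + Real.log (1 + R ^ 2))) * (logSobolevEnergy ξ).toReal := by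
  obtain ⟨hξm, hξs, hξE⟩ := hξ
  have hint : Integrable ξ := integrable_of_memLp_window hξm hξs
  obtain ⟨hηt, hηts⟩ := isWeilTest_weilConv_moll_window a hξm hξs k
  set η : ℝ → ℂ := weilConv ξ (moll k) with hη
  have hηm : MemLp η 2 volume := hηt.1.continuous.memLp_of_hasCompactSupport hηt.2
  have hηs : Function.support η ⊆ Icc (-(a + 1)) (a + 1) := (subset_tsupport _).trans hηts
  have hξs' : Function.support ξ ⊆ Icc (-(a + 1)) (a + 1) :=
    hξs.trans (Icc_subset_Icc (by linarith) (by linarith))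
  -- the difference and its transform
  have hdm : MemLp (fun x ↦ ξ x - η x) 2 volume := hξm.sub hηm
  have hds : Function.support (fun x ↦ ξ x - η x) ⊆ Icc (-(a + 1)) (a + 1) :=
    support_sub_subset_window hξs' hηs
  have hdi : Integrable (fun x ↦ ξ x - η x) := integrable_of_memLp_window hdm hds
  have hdiff : ∀ t : ℝ, weilMellin (fun x ↦ ξ x - η x) (1 / 2 + t * I) =
      weilMellin ξ (1 / 2 + t * I) * (1 - weilMellin (moll k) (1 / 2 + t * I)) := by
    intro t
    rw [weilMellin_sub_window hξm hξs' hηm hηs]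
    show weilMellin ξ (1 / 2 + t * I) - weilMellin (weilConv ξ (moll k)) (1 / 2 + t * I) = _
    rw [Yoshida1992.weilMellin_weilConv_half_line hint
      ((continuous_moll k).integrable_of_hasCompactSupport (hasCompactSupport_moll k))]
    ring
  -- Plancherel for the difference and for `ξ`
  have hPd := integral_norm_sq_weilMellin_half_line_of_memLp hdi hdm
  have hPξ := integral_norm_sq_weilMellin_half_line_of_memLp hint hξm
  have hPdi := integrable_norm_sq_weilMellin_half_line_of_memLp hdi hdm
  have hPξi := integrable_norm_sq_weilMellin_half_line_of_memLp hint hξm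
  obtain ⟨hEi, hEeq⟩ := integrable_energyIntegrand (a := a) ⟨hξm, hξs, hξE⟩
  set F : ℝ → ℝ := fun t ↦ ‖weilMellin ξ (1 / 2 + t * I)‖ ^ 2 with hF
  set L : ℝ := 1 + Real.log (1 + R ^ 2) with hL
  have hL1 : 1 ≤ L := one_le_logW R
  have hLpos : 0 < L := by linarith
  -- pointwise bound of the transform of the difference
  have hpt : ∀ t : ℝ, ‖weilMellin (fun x ↦ ξ x - η x) (1 / 2 + t * I)‖ ^ 2 ≤
      (R * (bump k).rOut) ^ 2 * F t + 4 / L * (F t * (1 + Real.log (1 + t ^ 2))) := by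
    intro t
    rw [hdiff t, norm_mul, mul_pow]
    have hFt : 0 ≤ F t := sq_nonneg _
    have hw1 := one_le_logW t
    have hr : 0 ≤ (bump k).rOut := (bump k).rOut_pos.le
    rcases le_or_gt |t| R with ht | ht
    · -- low frequencies: `|1 − φ̂|² ≤ (|t| r)² ≤ (R r)²`
      have h1 := norm_one_sub_weilMellin_moll_le k t
      have h2 : ‖1 - weilMellin (moll k) (1 / 2 + t * I)‖ ^ 2 ≤ (R * (bump k).rOut) ^ 2 := by
        have h3 : |t| * (bump k).rOut ≤ R * (bump k).rOut := mul_le_mul_of_nonneg_right ht hr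
        have h4 : 0 ≤ |t| * (bump k).rOut := by positivity
        nlinarith [norm_nonneg (1 - weilMellin (moll k) (1 / 2 + t * I))]
      have h5 : 0 ≤ 4 / L * (F t * (1 + Real.log (1 + t ^ 2))) := by positivity
      nlinarith
    · -- high frequencies: `|1 − φ̂|² ≤ 4 ≤ 4 logW(t)/L`
      have h1 : ‖1 - weilMellin (moll k) (1 / 2 + t * I)‖ ≤ 2 := by
        calc ‖1 - weilMellin (moll k) (1 / 2 + t * I)‖
            ≤ ‖(1 : ℂ)‖ + ‖weilMellin (moll k) (1 / 2 + t * I)‖ := norm_sub_le _ _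
          _ ≤ 1 + 1 := by rw [norm_one]; exact add_le_add le_rfl (norm_weilMellin_moll_half_le k t)
          _ = 2 := by norm_num
      have h2 : ‖1 - weilMellin (moll k) (1 / 2 + t * I)‖ ^ 2 ≤ 4 := by
        nlinarith [norm_nonneg (1 - weilMellin (moll k) (1 / 2 + t * I))]
      have h3 : L ≤ 1 + Real.log (1 + t ^ 2) := by
        simp only [hL]
        have : R ^ 2 ≤ t ^ 2 := by
          rw [← sq_abs t]; exact pow_le_pow_left₀ hR ht.le 2
        have := Real.log_le_log (by positivity : (0:ℝ) < 1 + R ^ 2) (by linarith : 1 + R ^ 2 ≤ 1 + t ^ 2)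
        linarith
      have h4 : (4 : ℝ) ≤ 4 / L * (1 + Real.log (1 + t ^ 2)) := by
        rw [div_mul_eq_mul_div, le_div_iff₀ hLpos]
        nlinarith
      have h6 : 0 ≤ (R * (bump k).rOut) ^ 2 * F t := by positivity
      nlinarith
  -- integrate
  have hI : ∫ t : ℝ, ‖weilMellin (fun x ↦ ξ x - η x) (1 / 2 + t * I)‖ ^ 2 ≤
      (R * (bump k).rOut) ^ 2 * (2 * π * ∫ x, ‖ξ x‖ ^ 2) +
        4 / L * (logSobolevEnergy ξ).toReal := by
    rw [hEeq, ← hPξ, ← integral_const_mul, ← integral_const_mul,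
      ← integral_add (hPξi.const_mul _) (hEi.const_mul _)]
    exact integral_mono hPdi ((hPξi.const_mul _).add (hEi.const_mul _)) hpt
  rw [hPd] at hI
  have hπ : 0 < π := Real.pi_pos
  set E : ℝ := (logSobolevEnergy ξ).toReal with hEdef
  set n2 : ℝ := ∫ x, ‖ξ x‖ ^ 2 with hn2
  set d2 : ℝ := ∫ x, ‖ξ x - η x‖ ^ 2 with hd2
  have hgoal : d2 ≤ ((R * (bump k).rOut) ^ 2 * (2 * π * n2) + 4 / L * E) / (2 * π) := by
    rw [le_div_iff₀ (by positivity)]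
    linarith
  calc d2 ≤ ((R * (bump k).rOut) ^ 2 * (2 * π * n2) + 4 / L * E) / (2 * π) := hgoal
    _ = (R * (bump k).rOut) ^ 2 * n2 + 2 / (π * L) * E := by
        field_simp
        ring

/-- The `L²` distance of two `L²` functions, as elements of `Lp ℂ 2`, is `√∫|f − g|²`. [folklore] -/
private theorem dist_toLp_eq_sqrt {f g : ℝ → ℂ} (hf : MemLp f 2 volume) (hg : MemLp g 2 volume) :
    dist (hf.toLp f) (hg.toLp g) = Real.sqrt (∫ x, ‖f x - g x‖ ^ 2) := by
  rw [Lp.dist_def]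
  have h : eLpNorm (⇑(hf.toLp f) - ⇑(hg.toLp g)) 2 volume = eLpNorm (f - g) 2 volume :=
    eLpNorm_congr_ae ((MemLp.coeFn_toLp hf).sub (MemLp.coeFn_toLp hg))
  rw [h, (hf.sub hg).eLpNorm_eq_integral_rpow_norm two_ne_zero ENNReal.ofNat_ne_top,
    ENNReal.toReal_ofReal (by positivity), ENNReal.toReal_ofNat, Real.sqrt_eq_rpow, one_div]
  congr 1
  refine integral_congr_ae (Eventually.of_forall fun x ↦ ?_)
  simp only [Pi.sub_apply, Real.rpow_two]

/-- Minkowski in the form used below: `√∫|f − h|² ≤ √∫|f − g|² + √∫|g − h|²`. [folklore] -/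
private theorem sqrt_integral_norm_sq_sub_le {f g h : ℝ → ℂ} (hf : MemLp f 2 volume)
    (hg : MemLp g 2 volume) (hh : MemLp h 2 volume) :
    Real.sqrt (∫ x, ‖f x - h x‖ ^ 2) ≤
      Real.sqrt (∫ x, ‖f x - g x‖ ^ 2) + Real.sqrt (∫ x, ‖g x - h x‖ ^ 2) := by
  rw [← dist_toLp_eq_sqrt hf hh, ← dist_toLp_eq_sqrt hf hg, ← dist_toLp_eq_sqrt hg hh]
  exact dist_triangle _ _ _

/-- **Rellich lemma for the log-energy on a window.** A sequence of window functions with bounded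
`L²` norm and bounded energy `‖·̂‖₁²` has a subsequence converging in `L²` to a window function: the
embedding of `Dom(QW_λ) = K̂(a)` (graph norm) into `L²[−a, a]` is compact. Proof: uniformly small tails
`ξ − ξ ⋆ φ_k` (previous lemma), Arzelà–Ascoli for the equicontinuous uniformly bounded mollified family on
the compact window `[−(a+1), a+1]`, whence total boundedness in `L²`, a complete space.
(This compactness is what Yoshida's coercive estimate `(φ, φ) ≥ µ‖φ‖²` on `K_N(a)` (Lemma 3) with
`‖χ_n‖²_W ∼ log|n|` encodes; it is used here in place of the matrix-continuity argument of his §7.)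
[cite: Yoshida1992HermitianForms, §0 pp. 282–283 (K̂_N(a) embedded in L²([−a,a]), Lemma 3); ConnesConsani2023, Lemma 2.2 and its proof, pp. 104–105] -/
theorem exists_subseq_tendsto_of_energy_le (ha : 0 < a) {M : ℝ} {u : ℕ → ℝ → ℂ}
    (hu : ∀ n, u n ∈ formDomain a) (hnorm : ∀ n, ∫ x, ‖u n x‖ ^ 2 ≤ 1)
    (hE : ∀ n, (logSobolevEnergy (u n)).toReal ≤ M) :
    ∃ ξ : ℝ → ℂ, MemLp ξ 2 volume ∧ Function.support ξ ⊆ Icc (-a) a ∧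
      ∃ φ : ℕ → ℕ, StrictMono φ ∧
        Tendsto (fun j ↦ ∫ x, ‖u (φ j) x - ξ x‖ ^ 2) atTop (𝓝 0) := by
  have hM : 0 ≤ M := (ENNReal.toReal_nonneg).trans (hE 0)
  -- the `L¹` bound `∫|u_n| ≤ √(2a)`
  have hL1 : ∀ n, ∫ x, ‖u n x‖ ≤ Real.sqrt (2 * a) := by
    intro n
    have h := sq_integral_norm_le (hu n).1 (hu n).2.1 ha
    have h2 : (∫ x, ‖u n x‖) ^ 2 ≤ 2 * a := h.trans (by nlinarith [hnorm n])
    exact (le_abs_self _).trans (Real.abs_le_sqrt h2)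
  -- the vectors in `L²`
  set v : ℕ → Lp ℂ 2 (volume : Measure ℝ) := fun n ↦ (hu n).1.toLp (u n) with hv
  -- total boundedness of the range
  have hTB : TotallyBounded (range v) := by
    refine Metric.totallyBounded_iff.2 fun ε hε ↦ ?_
    -- (i) choose `R`, then `k`, making the tails `ε/4`-small in `L²`
    set R : ℝ := Real.exp (64 * (M + 1) / (π * ε ^ 2)) with hRdef
    have hR : 0 ≤ R := (Real.exp_pos _).le
    have hLR : 64 * (M + 1) / (π * ε ^ 2) ≤ 1 + Real.log (1 + R ^ 2) := by
      have h1 : Real.log (1 + R ^ 2) ≥ Real.log R := by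
        refine Real.log_le_log (Real.exp_pos _) ?_
        nlinarith [Real.exp_pos (64 * (M + 1) / (π * ε ^ 2)), sq_nonneg (R - 1)]
      rw [hRdef, Real.log_exp] at h1
      linarith
    have hπ : 0 < π := Real.pi_pos
    have htail2 : 2 / (π * (1 + Real.log (1 + R ^ 2))) * M ≤ ε ^ 2 / 32 := by
      have hLpos : 0 < 1 + Real.log (1 + R ^ 2) := by linarith [one_le_logW R]
      rw [div_mul_eq_mul_div, div_le_div_iff₀ (by positivity) (by norm_num)]
      have : 64 * (M + 1) ≤ (1 + Real.log (1 + R ^ 2)) * (π * ε ^ 2) := by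
        rwa [div_le_iff₀ (by positivity)] at hLR
      nlinarith
    obtain ⟨k, hk⟩ : ∃ k : ℕ, (bump k).rOut < ε / (8 * (R + 1)) :=
      ((tendsto_order.1 tendsto_bump_rOut).2 _ (by positivity)).exists
    have htail1 : (R * (bump k).rOut) ^ 2 ≤ ε ^ 2 / 32 := by
      have hr : 0 ≤ (bump k).rOut := (bump k).rOut_pos.le
      have h1 : R * (bump k).rOut ≤ (R + 1) * (ε / (8 * (R + 1))) := by
        have : R * (bump k).rOut ≤ (R + 1) * (bump k).rOut := by nlinarith
        exact this.trans (mul_le_mul_of_nonneg_left hk.le (by linarith))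
      have h2 : (R + 1) * (ε / (8 * (R + 1))) = ε / 8 := by field_simp
      rw [h2] at h1
      have h3 : 0 ≤ R * (bump k).rOut := by positivity
      nlinarith
    have htail : ∀ n, Real.sqrt (∫ x, ‖u n x - weilConv (u n) (moll k) x‖ ^ 2) ≤ ε / 4 := by
      intro n
      have h := integral_norm_sq_sub_weilConv_moll_le (hu n) k hR
      have h2 : ∫ x, ‖u n x - weilConv (u n) (moll k) x‖ ^ 2 ≤ ε ^ 2 / 16 := by
        have hc : 0 ≤ 2 / (π * (1 + Real.log (1 + R ^ 2))) := by
          have := one_le_logW R; positivity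
        have h3 : (R * (bump k).rOut) ^ 2 * ∫ x, ‖u n x‖ ^ 2 ≤ ε ^ 2 / 32 * 1 :=
          mul_le_mul htail1 (hnorm n) (integral_nonneg fun _ ↦ by positivity) (by positivity)
        have h4 : 2 / (π * (1 + Real.log (1 + R ^ 2))) * (logSobolevEnergy (u n)).toReal ≤
            ε ^ 2 / 32 := (mul_le_mul_of_nonneg_left (hE n) hc).trans htail2
        linarith
      calc Real.sqrt (∫ x, ‖u n x - weilConv (u n) (moll k) x‖ ^ 2) ≤ Real.sqrt (ε ^ 2 / 16) :=
            Real.sqrt_le_sqrt h2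
        _ = ε / 4 := by
            rw [show ε ^ 2 / 16 = (ε / 4) ^ 2 by ring, Real.sqrt_sq (by positivity)]
    -- (ii) the mollified family on the compact window `K = [−(a+1), a+1]`
    set A : ℝ := a + 1 with hAdef
    set w : ℕ → ℝ → ℂ := fun n ↦ weilConv (u n) (moll k) with hw
    have hwt : ∀ n, IsWeilTest (w n) ∧ tsupport (w n) ⊆ Icc (-A) A := fun n ↦
      isWeilTest_weilConv_moll_window a (hu n).1 (hu n).2.1 k
    have hwm : ∀ n, MemLp (w n) 2 volume := fun n ↦
      (hwt n).1.1.continuous.memLp_of_hasCompactSupport (hwt n).1.2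
    have hws : ∀ n, Function.support (w n) ⊆ Icc (-A) A := fun n ↦
      (subset_tsupport _).trans (hwt n).2
    obtain ⟨Cm, hCm⟩ := (continuous_moll k).bounded_above_of_compact_support (hasCompactSupport_moll k)
    have hCm0 : 0 ≤ Cm := (norm_nonneg _).trans (hCm 0)
    -- uniform bound and modulus of continuity of the family
    have hwbd : ∀ n x, ‖w n x‖ ≤ Cm * Real.sqrt (2 * a) := by
      intro n x
      rw [hw]; dsimp only
      rw [weilConv_apply]
      calc ‖∫ t : ℝ, u n t * moll k (x - t)‖ ≤ ∫ t : ℝ, ‖u n t * moll k (x - t)‖ :=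
            norm_integral_le_integral_norm _
        _ ≤ ∫ t : ℝ, ‖u n t‖ * Cm := by
            refine integral_mono_of_nonneg (Eventually.of_forall fun _ ↦ norm_nonneg _)
              ((integrable_of_memLp_window (hu n).1 (hu n).2.1).norm.mul_const _)
              (Eventually.of_forall fun t ↦ ?_)
            dsimp only
            rw [norm_mul]
            exact mul_le_mul_of_nonneg_left (hCm _) (norm_nonneg _)
        _ ≤ Cm * Real.sqrt (2 * a) := by
            rw [integral_mul_const, mul_comm]
            exact mul_le_mul_of_nonneg_left (hL1 n) hCm0
    have hwmod : ∀ δ > 0, ∃ ρ > 0, ∀ n x y, dist x y < ρ → dist (w n x) (w n y) ≤ δ := by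
      intro δ hδ
      have huc := (hasCompactSupport_moll k).uniformContinuous_of_continuous (continuous_moll k)
      obtain ⟨ρ, hρ, hρ'⟩ := Metric.uniformContinuous_iff.1 huc (δ / (Real.sqrt (2 * a) + 1))
        (by positivity)
      refine ⟨ρ, hρ, fun n x y hxy ↦ ?_⟩
      rw [dist_eq_norm, hw]
      dsimp only
      have hmi : ∀ z : ℝ, Integrable (fun s : ℝ ↦ u n s * moll k (z - s)) := fun z ↦ by
        have hc : Continuous (fun s : ℝ ↦ moll k (z - s)) :=
          (continuous_moll k).comp (continuous_const.sub continuous_id)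
        exact (integrable_of_memLp_window (hu n).1 (hu n).2.1).mul_bdd hc.aestronglyMeasurable
          (Eventually.of_forall fun s ↦ hCm _)
      rw [weilConv_apply, weilConv_apply, ← integral_sub (hmi x) (hmi y)]
      calc ‖∫ t : ℝ, (u n t * moll k (x - t) - u n t * moll k (y - t))‖
          ≤ ∫ t : ℝ, ‖u n t * moll k (x - t) - u n t * moll k (y - t)‖ :=
            norm_integral_le_integral_norm _
        _ ≤ ∫ t : ℝ, ‖u n t‖ * (δ / (Real.sqrt (2 * a) + 1)) := by
            refine integral_mono_of_nonneg (Eventually.of_forall fun _ ↦ norm_nonneg _)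
              ((integrable_of_memLp_window (hu n).1 (hu n).2.1).norm.mul_const _)
              (Eventually.of_forall fun t ↦ ?_)
            dsimp only
            rw [← mul_sub, norm_mul]
            refine mul_le_mul_of_nonneg_left ?_ (norm_nonneg _)
            have hd : dist (x - t) (y - t) < ρ := by
              rw [Real.dist_eq] at hxy ⊢
              rwa [show x - t - (y - t) = x - y by ring]
            have := hρ' hd
            rw [dist_eq_norm] at this
            exact this.le
        _ = (∫ t : ℝ, ‖u n t‖) * (δ / (Real.sqrt (2 * a) + 1)) := integral_mul_const _ _
        _ ≤ Real.sqrt (2 * a) * (δ / (Real.sqrt (2 * a) + 1)) :=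
            mul_le_mul_of_nonneg_right (hL1 n) (by positivity)
        _ ≤ δ := by
            rw [mul_div_assoc']
            rw [div_le_iff₀ (by positivity)]
            nlinarith [Real.sqrt_nonneg (2 * a)]
    -- bounded continuous functions on the compact window
    let K : Type := Icc (-A) A
    let G : ℕ → BoundedContinuousFunction K ℂ := fun n ↦
      BoundedContinuousFunction.mkOfCompact
        ⟨fun x ↦ w n x.1, (hwt n).1.1.continuous.comp continuous_subtype_val⟩
    have hG : ∀ n (x : K), G n x = w n x.1 := fun n x ↦ rfl
    have hGeq : Equicontinuous (fun n ↦ (G n : K → ℂ)) := by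
      intro x₀
      rw [Metric.equicontinuousAt_iff_right]
      intro δ hδ
      obtain ⟨ρ, hρ, hρ'⟩ := hwmod (δ / 2) (half_pos hδ)
      filter_upwards [Metric.ball_mem_nhds x₀ hρ] with x hx n
      rw [hG, hG]
      have hd : dist x₀.1 x.1 < ρ := by
        rw [dist_comm]; exact hx
      exact (hρ' n _ _ hd).trans_lt (half_lt_self hδ)
    set Aset : Set (BoundedContinuousFunction K ℂ) := range G with hAset
    have hin : ∀ (f : BoundedContinuousFunction K ℂ) (x : K), f ∈ Aset →
        f x ∈ Metric.closedBall (0 : ℂ) (Cm * Real.sqrt (2 * a)) := by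
      rintro f x ⟨n, rfl⟩
      rw [Metric.mem_closedBall, dist_zero_right, hG]
      exact hwbd n x.1
    have hAeq : Equicontinuous ((↑) : Aset → K → ℂ) := by
      have hch : ∀ f : Aset, ∃ n, G n = f.1 := fun f ↦ f.2
      choose idx hidx using hch
      have e : ((↑) : Aset → K → ℂ) = (fun n ↦ (G n : K → ℂ)) ∘ idx := by
        funext f
        simp only [Function.comp_apply, hidx f]
      rw [e]
      exact hGeq.comp idx
    have hcomp : IsCompact (closure Aset) :=
      BoundedContinuousFunction.arzela_ascoli (Metric.closedBall (0 : ℂ) (Cm * Real.sqrt (2 * a)))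
        (isCompact_closedBall _ _) Aset hin hAeq
    have hTBA : TotallyBounded Aset := hcomp.totallyBounded.subset subset_closure
    -- (iii) a finite net of indices
    set ε₁ : ℝ := ε / (4 * (Real.sqrt (2 * A) + 1)) with hε₁
    have hA0 : 0 < A := by rw [hAdef]; linarith
    have hε₁pos : 0 < ε₁ := by positivity
    obtain ⟨t, htA, htfin, hcover⟩ :=
      totallyBounded_iff_subset.1 hTBA _ (Metric.dist_mem_uniformity hε₁pos)
    have hch : ∀ f : t, ∃ n, G n = f.1 := fun f ↦ htA f.2
    choose jdx hjdx using hch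
    haveI : Fintype t := htfin.fintype
    refine ⟨Set.range (fun f : t ↦ v (jdx f)), Set.finite_range _, ?_⟩
    rintro _ ⟨n, rfl⟩
    obtain ⟨f, hft, hfn⟩ : ∃ f ∈ t, dist (G n) f < ε₁ := by
      have := hcover ⟨n, rfl⟩
      simp only [mem_iUnion, mem_setOf_eq, exists_prop] at this
      exact this
    refine mem_iUnion₂.2 ⟨v (jdx ⟨f, hft⟩), ⟨⟨f, hft⟩, rfl⟩, ?_⟩
    set m : ℕ := jdx ⟨f, hft⟩ with hm
    have hGm : G m = f := hjdx ⟨f, hft⟩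
    rw [Metric.mem_ball]
    -- sup-closeness of the mollified functions ⇒ `L²`-closeness
    have hsup : ∀ x : ℝ, ‖w n x - w m x‖ ≤ ε₁ := by
      intro x
      by_cases hx : x ∈ Icc (-A) A
      · have h := BoundedContinuousFunction.dist_coe_le_dist (f := G n) (g := G m) ⟨x, hx⟩
        rw [hG, hG, dist_eq_norm, hGm] at h
        exact h.trans hfn.le
      · rw [Function.notMem_support.1 (fun h ↦ hx (hws n h)),
          Function.notMem_support.1 (fun h ↦ hx (hws m h))]
        simp [hε₁pos.le]
    have hmid : Real.sqrt (∫ x, ‖w n x - w m x‖ ^ 2) ≤ ε / 4 := by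
      have hsupp : Function.support (fun x ↦ w n x - w m x) ⊆ Icc (-A) A :=
        support_sub_subset_window (hws n) (hws m)
      have h1 : ∫ x, ‖w n x - w m x‖ ^ 2 ≤ ε₁ ^ 2 * (2 * A) := by
        have e1 : ∫ x, ‖w n x - w m x‖ ^ 2 = ∫ x in Icc (-A) A, ‖w n x - w m x‖ ^ 2 := by
          refine (setIntegral_eq_integral_of_forall_compl_eq_zero fun x hx ↦ ?_).symm
          rw [Function.notMem_support.1 (fun h ↦ hx (hsupp h))]; simp
        rw [e1]
        calc ∫ x in Icc (-A) A, ‖w n x - w m x‖ ^ 2 ≤ ∫ x in Icc (-A) A, ε₁ ^ 2 := by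
              refine setIntegral_mono_on ?_ (continuous_const.continuousOn.integrableOn_compact
                isCompact_Icc) measurableSet_Icc fun x _ ↦ ?_
              · exact (integrable_norm_sq_of_memLp ((hwm n).sub (hwm m))).integrableOn
              · have := hsup x
                have h0 := norm_nonneg (w n x - w m x)
                nlinarith
          _ = ε₁ ^ 2 * (2 * A) := by
              rw [setIntegral_const, smul_eq_mul, Real.volume_real_Icc_of_le (by linarith)]
              ring
      calc Real.sqrt (∫ x, ‖w n x - w m x‖ ^ 2) ≤ Real.sqrt (ε₁ ^ 2 * (2 * A)) :=
            Real.sqrt_le_sqrt h1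
        _ = ε₁ * Real.sqrt (2 * A) := by
            rw [Real.sqrt_mul (sq_nonneg _), Real.sqrt_sq hε₁pos.le]
        _ ≤ ε / 4 := by
            rw [hε₁, div_mul_eq_mul_div, div_le_div_iff₀ (by positivity) (by norm_num)]
            nlinarith [Real.sqrt_nonneg (2 * A), hε.le]
    -- assemble with the tails
    have hvn : dist (v n) (v m) = Real.sqrt (∫ x, ‖u n x - u m x‖ ^ 2) :=
      dist_toLp_eq_sqrt (hu n).1 (hu m).1
    rw [hvn]
    have h3 := htail m
    have h3' : Real.sqrt (∫ x, ‖w m x - u m x‖ ^ 2) ≤ ε / 4 := by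
      have e : (fun x ↦ ‖w m x - u m x‖ ^ 2) = fun x ↦ ‖u m x - w m x‖ ^ 2 := by
        funext x; rw [norm_sub_rev]
      rw [show (∫ x, ‖w m x - u m x‖ ^ 2) = ∫ x, ‖u m x - w m x‖ ^ 2 from by rw [e]]
      exact h3
    calc Real.sqrt (∫ x, ‖u n x - u m x‖ ^ 2)
        ≤ Real.sqrt (∫ x, ‖u n x - w n x‖ ^ 2) + Real.sqrt (∫ x, ‖w n x - u m x‖ ^ 2) :=
          sqrt_integral_norm_sq_sub_le (hu n).1 (hwm n) (hu m).1
      _ ≤ Real.sqrt (∫ x, ‖u n x - w n x‖ ^ 2) +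
            (Real.sqrt (∫ x, ‖w n x - w m x‖ ^ 2) + Real.sqrt (∫ x, ‖w m x - u m x‖ ^ 2)) :=
          add_le_add le_rfl (sqrt_integral_norm_sq_sub_le (hwm n) (hwm m) (hu m).1)
      _ ≤ ε / 4 + (ε / 4 + ε / 4) := add_le_add (htail n) (add_le_add hmid h3')
      _ < ε := by linarith
  -- compactness of the closure and a convergent subsequence
  have hc : IsCompact (closure (range v)) := hTB.closure.isCompact_of_isClosed isClosed_closure
  obtain ⟨y, -, φ, hφ, hlim⟩ := hc.tendsto_subseq fun n ↦ subset_closure (mem_range_self n)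
  -- the limit as a window function
  set ξ' : ℝ → ℂ := (y : ℝ → ℂ) with hξ'
  have hξ'm : MemLp ξ' 2 volume := Lp.memLp y
  set ξ : ℝ → ℂ := (Icc (-a) a).indicator ξ' with hξdef
  have hξm : MemLp ξ 2 volume := hξ'm.indicator measurableSet_Icc
  refine ⟨ξ, hξm, Set.support_indicator_subset, φ, hφ, ?_⟩
  -- `∫|u_{φ j} − y|² → 0`
  have h1 : Tendsto (fun j ↦ ∫ x, ‖u (φ j) x - ξ' x‖ ^ 2) atTop (𝓝 0) := by
    have hd := tendsto_iff_dist_tendsto_zero.1 hlim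
    have e : ∀ j, dist ((v ∘ φ) j) y = Real.sqrt (∫ x, ‖u (φ j) x - ξ' x‖ ^ 2) := by
      intro j
      have := dist_toLp_eq_sqrt (hu (φ j)).1 hξ'm
      rwa [Lp.toLp_coeFn y hξ'm] at this
    have h2 : Tendsto (fun j ↦ (Real.sqrt (∫ x, ‖u (φ j) x - ξ' x‖ ^ 2)) ^ 2) atTop (𝓝 0) := by
      have := (hd.congr e).pow 2
      simpa using this
    refine h2.congr fun j ↦ ?_
    exact Real.sq_sqrt (integral_nonneg fun _ ↦ by positivity)
  -- cutting off outside the window only decreases the distance to the `u`'s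
  have hle : ∀ j, ∫ x, ‖u (φ j) x - ξ x‖ ^ 2 ≤ ∫ x, ‖u (φ j) x - ξ' x‖ ^ 2 := by
    intro j
    refine integral_mono_of_nonneg (Eventually.of_forall fun _ ↦ by positivity)
      (integrable_norm_sq_of_memLp ((hu (φ j)).1.sub hξ'm)) (Eventually.of_forall fun x ↦ ?_)
    by_cases hx : x ∈ Icc (-a) a
    · simp only [hξdef, Set.indicator_of_mem hx]; exact le_rfl
    · have hu0 : u (φ j) x = 0 := Function.notMem_support.1 fun h ↦ hx ((hu (φ j)).2.1 h)
      simp only [hξdef, Set.indicator_of_notMem hx, hu0, sub_zero, norm_zero, ne_eq,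
        OfNat.ofNat_ne_zero, not_false_eq_true, zero_pow, zero_sub, norm_neg]
      positivity
  exact tendsto_of_tendsto_of_tendsto_of_le_of_le tendsto_const_nhds h1
    (fun j ↦ integral_nonneg fun _ ↦ by positivity) hle

end Rellich

/-! ## D. At Yoshida's threshold the completed form degenerates (¬RH) -/

section Threshold

/-- `E_N(0) = 0`. [folklore] -/
private theorem weilFinitePrimeQuadratic_zero (N : ℕ) : weilFinitePrimeQuadratic N 0 = 0 := by
  have h := weilFinitePrimeQuadratic_smul N 0 (0 : ℝ → ℂ)
  rw [zero_smul, norm_zero] at h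
  simpa using h

/-- `primeCutoff` is monotone in the window. [cite: ConnesConsani2023, Prop. 2.1 eq. (2.11) (the range 1 < n ≤ λ²), p. 103] -/
theorem primeCutoff_mono {a b : ℝ} (hab : a ≤ b) : primeCutoff a ≤ primeCutoff b := by
  unfold primeCutoff
  exact Nat.floor_le_floor (Real.exp_le_exp.2 (by linarith))

/-- `∫ |c ξ|² = |c|² ∫ |ξ|²`. [folklore] -/
private theorem integral_norm_sq_smul (c : ℂ) (ξ : ℝ → ℂ) :
    ∫ x, ‖(c • ξ) x‖ ^ 2 = ‖c‖ ^ 2 * ∫ x, ‖ξ x‖ ^ 2 := by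
  rw [← integral_const_mul]
  refine integral_congr_ae (Eventually.of_forall fun x ↦ ?_)
  simp only [Pi.smul_apply, smul_eq_mul, norm_mul, mul_pow]

/-- **Negative unit vectors past the threshold with bounded energy.** If RH fails, then for every
`n` there is a test function `u_n` supported in `[−a_n, a_n]`, `a_n = a₀ + 1/(n+1)`, with `∫|u_n|² = 1`,
`E_{N₁}(u_n) < 0` (`N₁ = ⌊e^{2(a₀+1)}⌋`), and energies `‖û_n‖₁²` bounded independently of `n` — Yoshida's
Prop. 6 (2) supplies the negative vectors, energy coercivity bounds them.
[cite: Yoshida1992HermitianForms, Prop. 6 (p. 320) and the proof of Thm. 2 (p. 321)] -/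
theorem exists_negative_unit_seq_of_not_riemannHypothesis (hRH : ¬ RiemannHypothesis) :
    ∃ M : ℝ, ∃ u : ℕ → ℝ → ℂ, ∀ n,
      IsWeilTest (u n) ∧
      tsupport (u n) ⊆ Icc (-(weilPositivityThreshold + 1 / ((n : ℝ) + 1)))
        (weilPositivityThreshold + 1 / ((n : ℝ) + 1)) ∧
      ∫ x, ‖u n x‖ ^ 2 = 1 ∧
      weilFinitePrimeQuadratic (primeCutoff (weilPositivityThreshold + 1)) (u n) < 0 ∧
      (logSobolevEnergy (u n)).toReal ≤ M := by
  set a₀ := weilPositivityThreshold with ha₀def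
  obtain ⟨hlow, -, hfail⟩ := Yoshida1992_prop6 hRH
  have ha₀ : 0 < a₀ := lt_of_lt_of_le (by positivity) hlow
  set a₁ : ℝ := a₀ + 1 with ha₁def
  have ha₁ : 0 < a₁ := by positivity
  set N₁ : ℕ := primeCutoff a₁ with hN₁
  obtain ⟨C, hC⟩ := exists_energy_le ha₁ N₁
  -- for each `n` a negative unit test vector
  have key : ∀ n : ℕ, ∃ u : ℝ → ℂ, IsWeilTest u ∧
      tsupport u ⊆ Icc (-(a₀ + 1 / ((n : ℝ) + 1))) (a₀ + 1 / ((n : ℝ) + 1)) ∧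
      ∫ x, ‖u x‖ ^ 2 = 1 ∧ weilFinitePrimeQuadratic N₁ u < 0 := by
    intro n
    set b : ℝ := a₀ + 1 / ((n : ℝ) + 1) with hb
    have hb₀ : a₀ < b := by
      have : (0 : ℝ) < 1 / ((n : ℝ) + 1) := by positivity
      simp only [hb]
      linarith
    have hb₁ : b ≤ a₁ := by
      have : 1 / ((n : ℝ) + 1) ≤ 1 := by
        rw [div_le_one (by positivity)]; linarith [(Nat.cast_nonneg n : (0 : ℝ) ≤ n)]
      simp only [hb, ha₁def]; linarith
    have hneg := hfail b hb₀
    simp only [WeilPositivityOn, not_forall, not_le, exists_prop] at hneg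
    obtain ⟨g, hg, hgs, hgneg⟩ := hneg
    -- `Re Q(g) = E_{N₁}(g)`
    have hwin : tsupport g ⊆ Icc (-(Real.log ((N₁ : ℝ) + 1) / 2)) (Real.log ((N₁ : ℝ) + 1) / 2) := by
      have h1 := le_log_primeCutoff_add_one_div_two a₁
      exact hgs.trans (Icc_subset_Icc (by linarith) (by linarith))
    have hE : weilFinitePrimeQuadratic N₁ g < 0 := by
      have h := weilQuadratic_eq_weilFinitePrimeQuadratic hg N₁ hwin
      rw [h, Complex.ofReal_re] at hgneg
      exact hgneg
    -- `g ≠ 0` in `L²`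
    set n2 : ℝ := ∫ x, ‖g x‖ ^ 2 with hn2
    have hn2pos : 0 < n2 := by
      rcases (integral_nonneg (fun x ↦ by positivity) : 0 ≤ n2).lt_or_eq with h | h
      · exact h
      · exfalso
        -- `∫|g|² = 0` forces `g = 0`, but `E_N(0) = 0`
        have hgi : Integrable (fun x ↦ ‖g x‖ ^ 2) :=
          integrable_norm_sq_of_memLp (hg.1.continuous.memLp_of_hasCompactSupport hg.2)
        have hae : (fun x ↦ ‖g x‖ ^ 2) =ᵐ[volume] 0 :=
          (integral_eq_zero_iff_of_nonneg (fun x ↦ by positivity) hgi).1 h.symm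
        have hg0 : g = 0 := by
          have hc : Continuous fun x ↦ ‖g x‖ ^ 2 := (hg.1.continuous.norm).pow 2
          have h0 : (fun x ↦ ‖g x‖ ^ 2) = 0 :=
            (Continuous.ae_eq_iff_eq volume hc continuous_const).1 hae
          funext x
          have := congr_fun h0 x
          simpa using this
        rw [hg0, weilFinitePrimeQuadratic_zero] at hE
        exact lt_irrefl _ hE
    -- normalise
    set c : ℂ := (((Real.sqrt n2)⁻¹ : ℝ) : ℂ) with hc
    have hgC : g ∈ Yoshida1992.C b := Yoshida1992.mem_C.2 ⟨hg, hgs⟩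
    have huC : c • g ∈ Yoshida1992.C b := (Yoshida1992.C b).smul_mem c hgC
    obtain ⟨hu, hus⟩ := Yoshida1992.mem_C.1 huC
    have hcn : ‖c‖ ^ 2 = n2⁻¹ := by
      rw [hc, Complex.norm_real, Real.norm_eq_abs, abs_inv, abs_of_nonneg (Real.sqrt_nonneg _),
        inv_pow, Real.sq_sqrt hn2pos.le]
    refine ⟨c • g, hu, hus, ?_, ?_⟩
    · rw [integral_norm_sq_smul, hcn, ← hn2, inv_mul_cancel₀ hn2pos.ne']
    · rw [weilFinitePrimeQuadratic_smul, hcn]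
      exact mul_neg_of_pos_of_neg (inv_pos.2 hn2pos) hE
  choose u hu hus hun huE using key
  refine ⟨4 * π * 0 + C * 1, u, fun n ↦ ⟨hu n, hus n, hun n, huE n, ?_⟩⟩
  -- energy bound from coercivity on the window `a₁`
  have hb₁ : a₀ + 1 / ((n : ℝ) + 1) ≤ a₁ := by
    have : 1 / ((n : ℝ) + 1) ≤ 1 := by
      rw [div_le_one (by positivity)]; linarith [(Nat.cast_nonneg n : (0 : ℝ) ≤ n)]
    simp only [ha₁def]; linarith
  have huD : u n ∈ formDomain a₁ :=
    mem_formDomain_of_isWeilTest (hu n) ((hus n).trans (Icc_subset_Icc (by linarith) hb₁))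
  have h := hC (u n) huD
  rw [hun n] at h
  nlinarith [huE n, Real.pi_pos]

end Threshold

/-! ## E. Under RH the completed form is positive definite on every window (Thm. 2 `⟹`) -/

section PositiveDefinite

/-- The transform of a window function at a complex point: `|ξ̂(s)| ≤ e^{|Re s − ½| a} ∫|ξ|`.
[cite: Yoshida1992HermitianForms, proof of Thm. 2, p. 321 («|Φ(s)| ≤ ∫|φ(x)|e^{(σ−1/2)|x|}dx ≤ √(2a)‖φ‖ e^{|σ−1/2|a}»)] -/
theorem norm_weilMellin_le_of_window {ξ : ℝ → ℂ} (hξm : MemLp ξ 2 volume)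
    (hξs : Function.support ξ ⊆ Icc (-a) a) (s : ℂ) :
    ‖weilMellin ξ s‖ ≤ Real.exp (|s.re - 1 / 2| * a) * ∫ x, ‖ξ x‖ := by
  have hint : Integrable ξ := integrable_of_memLp_window hξm hξs
  have hzero : ∀ x, x ∉ Icc (-a) a → ξ x = 0 := fun x hx ↦ eq_zero_of_support_subset hξs hx
  have hpt : ∀ x : ℝ, ‖ξ x * cexp ((s - 1 / 2) * x)‖ ≤ Real.exp (|s.re - 1 / 2| * a) * ‖ξ x‖ := by
    intro x
    by_cases hx : x ∈ Icc (-a) a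
    · rw [norm_mul, Complex.norm_exp, mul_comm]
      refine mul_le_mul_of_nonneg_right (Real.exp_le_exp.2 ?_) (norm_nonneg _)
      have hre : ((s - 1 / 2) * (x : ℂ)).re = (s.re - 1 / 2) * x := by
        simp [Complex.mul_re, sub_re]
      rw [hre]
      calc (s.re - 1 / 2) * x ≤ |(s.re - 1 / 2) * x| := le_abs_self _
        _ = |s.re - 1 / 2| * |x| := abs_mul _ _
        _ ≤ |s.re - 1 / 2| * a := mul_le_mul_of_nonneg_left (abs_le.2 ⟨hx.1, hx.2⟩) (abs_nonneg _)
    · rw [hzero x hx]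
      simp
  unfold weilMellin
  calc ‖∫ t : ℝ, ξ t * cexp ((s - 1 / 2) * t)‖ ≤ ∫ t : ℝ, ‖ξ t * cexp ((s - 1 / 2) * t)‖ :=
        norm_integral_le_integral_norm _
    _ ≤ ∫ t : ℝ, Real.exp (|s.re - 1 / 2| * a) * ‖ξ t‖ :=
        integral_mono_of_nonneg (Eventually.of_forall fun _ ↦ norm_nonneg _)
          (hint.norm.const_mul _) (Eventually.of_forall hpt)
    _ = Real.exp (|s.re - 1 / 2| * a) * ∫ x, ‖ξ x‖ := integral_const_mul _ _

/-- The transform of a window function is entire (Paley–Wiener, easy half; tree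
`Literature.Analysis.Fourier.differentiable_fourierLaplace` in the `weilMellin` normalisation).
[cite: Yoshida1992HermitianForms, proof of Thm. 2, pp. 321–322 («Φ(s) is an entire function of order ≤ 1, exponential type a»)] -/
theorem differentiable_weilMellin_of_window {ξ : ℝ → ℂ} (hξm : MemLp ξ 2 volume)
    (hξs : Function.support ξ ⊆ Icc (-a) a) : Differentiable ℂ (weilMellin ξ) := by
  have hint : Integrable ξ := integrable_of_memLp_window hξm hξs
  set A : ℝ := max a 0 with hA
  have hzero : ∀ x, x ∉ Icc (-A) A → ξ x = 0 := fun x hx ↦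
    eq_zero_of_support_subset (hξs.trans (Icc_subset_Icc (neg_le_neg (le_max_left a 0))
      (le_max_left _ _))) hx
  have hFL := Literature.Analysis.Fourier.differentiable_fourierLaplace hint (le_max_right a 0) hzero
  have hlin : Differentiable ℂ fun s : ℂ ↦ (s - 1 / 2) * I / (2 * π) := by fun_prop
  have hcomp := hFL.comp hlin
  have e : weilMellin ξ = (fun z : ℂ ↦ ∫ v : ℝ, cexp (((-(2 * π * v) : ℝ) : ℂ) * z * I) * ξ v) ∘
      fun s : ℂ ↦ (s - 1 / 2) * I / (2 * π) := by
    funext s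
    simp only [Function.comp_apply, weilMellin]
    refine integral_congr_ae (Eventually.of_forall fun v ↦ ?_)
    show ξ v * cexp ((s - 1 / 2) * (v : ℂ)) =
      cexp (((-(2 * π * v) : ℝ) : ℂ) * ((s - 1 / 2) * I / (2 * π)) * I) * ξ v
    rw [mul_comm (ξ v)]
    congr 2
    have hπ : (π : ℂ) ≠ 0 := by exact_mod_cast Real.pi_ne_zero
    push_cast
    field_simp
    ring_nf
    rw [I_sq]
    ring
  rw [e]
  exact hcomp

/-- **Under RH the truncated zero sides are bounded by the form**: for a test function `η` and every
`T`, `Σ_{ρ ∈ Z_T} m(ρ) |η̂(ρ)|² ≤ Re Q(η)` (`Z_T` = zeros with `|Im ρ| ≤ T`): under RH each summand of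
the zero side of the explicit formula for `η ⋆ η̃` is `m(ρ)|η̂(ρ)|² ≥ 0` and the partial sums increase
to `Q(η)`. [cite: Yoshida1992HermitianForms, proof of Thm. 2, p. 321 («(φ_n, φ_n) = Σ_ρ |Φ_n(ρ)|²»); Bombieri 2000 §3 eq. (3.2)] -/
theorem sum_zeroOrder_mul_norm_sq_le_re_weilQuadratic (hRH : RiemannHypothesis) {η : ℝ → ℂ}
    (hη : IsWeilTest η) (T : ℝ) :
    ∑ ρ ∈ (weilZeroIndex_finite T).toFinset,
        (riemannZetaZeroOrder ρ : ℝ) * ‖weilMellin η ρ‖ ^ 2 ≤ (weilQuadratic η).re := by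
  set k : ℝ → ℂ := weilConv η (weilReflect η) with hk
  have hkt : IsWeilTest k := hη.weilConv hη.weilReflect
  -- under RH the indexed zeros lie on the critical line
  have hcrit : ∀ {T' : ℝ} {ρ : ℂ}, ρ ∈ weilZeroIndex T' → ρ.re = 1 / 2 ∧ ρ ≠ 1 := by
    rintro T' ρ ⟨hζ, -, -, him, -⟩
    have hne : ρ ≠ 1 := by rintro rfl; simp at him
    refine ⟨hRH ρ hζ ?_ hne, hne⟩
    rintro ⟨n, rfl⟩
    simp at him
  -- the partial sums as real Finset sums
  set P : ℝ → ℝ := fun T' ↦ ∑ ρ ∈ (weilZeroIndex_finite T').toFinset,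
    (riemannZetaZeroOrder ρ : ℝ) * ‖weilMellin η ρ‖ ^ 2 with hP
  have hPeq : ∀ T', (weilZeroSidePartial k T').re = P T' := by
    intro T'
    simp only [weilZeroSidePartial, hP]
    rw [finsum_mem_eq_finite_toFinset_sum _ (weilZeroIndex_finite T'), Complex.re_sum]
    refine Finset.sum_congr rfl fun ρ hρ ↦ ?_
    have hρ' : ρ ∈ weilZeroIndex T' := (weilZeroIndex_finite T').mem_toFinset.1 hρ
    rw [hk, weilMellin_weilQuadratic_of_re_eq hη (hcrit hρ').1, ← Complex.ofReal_intCast,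
      ← Complex.ofReal_mul, Complex.ofReal_re, Complex.normSq_eq_norm_sq]
  have hmono : Monotone P := by
    intro T₁ T₂ h12
    simp only [hP]
    refine Finset.sum_le_sum_of_subset_of_nonneg ?_ fun ρ hρ _ ↦ ?_
    · exact Set.Finite.toFinset_subset_toFinset.2 fun ρ ⟨h1, h2, h3, h4, h5⟩ ↦
        ⟨h1, h2, h3, h4, h5.trans h12⟩
    · have hρ' : ρ ∈ weilZeroIndex T₂ := (weilZeroIndex_finite T₂).mem_toFinset.1 hρ
      exact mul_nonneg (by exact_mod_cast riemannZetaZeroOrder_nonneg (hcrit hρ').2) (sq_nonneg _)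
  have htends : Tendsto P atTop (𝓝 (weilQuadratic η).re) := by
    have h := (Complex.continuous_re.tendsto _).comp (explicit_formula_holds hkt)
    have e : (fun T' ↦ (weilZeroSidePartial k T').re) = P := funext hPeq
    rw [← e]
    exact h
  exact hmono.ge_of_tendsto htends T

/-- **Under RH a null vector of the completed form has its transform vanishing at every zero**:
if `ξ ∈ Dom(QW_λ)` on the window `[−a, a]` and `E(ξ) = 0`, then `ξ̂(ρ) = 0` for every zero `ρ` of `ζ`
in the closed strip with `Im ρ ≠ 0` — by density of `C(a)` (graph norm), the previous bound and
pointwise convergence of the transforms at `ρ`. [cite: Yoshida1992HermitianForms, proof of Thm. 2, p. 321 («Hence we immediately obtain Φ(ρ) = 0 for every non-trivial zero ρ»)] -/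
theorem weilMellin_eq_zero_of_null (hRH : RiemannHypothesis) (ha : 0 < a) {ξ : ℝ → ℂ}
    (hξ : ξ ∈ formDomain a) (hE : weilFinitePrimeQuadratic (primeCutoff a) ξ = 0) {T : ℝ} {ρ : ℂ}
    (hρ : ρ ∈ weilZeroIndex T) : weilMellin ξ ρ = 0 := by
  obtain ⟨η, hηC, hηE⟩ := exists_seq_C_tendsto_energy ha hξ
  have hηt : ∀ m, IsWeilTest (η m) := fun m ↦ (Yoshida1992.mem_C.1 (hηC m)).1
  have hηs : ∀ m, tsupport (η m) ⊆ Icc (-a) a := fun m ↦ (Yoshida1992.mem_C.1 (hηC m)).2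
  have hηD : ∀ m, η m ∈ formDomain a := fun m ↦ mem_formDomain_of_isWeilTest (hηt m) (hηs m)
  have hη' : ∀ m, MemLp (η m) 2 volume ∧ Function.support (η m) ⊆ Icc (-a) a :=
    fun m ↦ ⟨(hηD m).1, (hηD m).2.1⟩
  set N := primeCutoff a with hN
  -- `E_N(η_m) → 0` and `E_N(η_m) = Re Q(η_m)`
  have hElim : Tendsto (fun m ↦ weilFinitePrimeQuadratic N (η m)) atTop (𝓝 0) := by
    have := tendsto_weilFinitePrimeQuadratic_of_energy ha hξ hηD hηE N
    rwa [hE] at this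
  have hQ : ∀ m, (weilQuadratic (η m)).re = weilFinitePrimeQuadratic N (η m) := by
    intro m
    have hwin : tsupport (η m) ⊆ Icc (-(Real.log ((N : ℝ) + 1) / 2)) (Real.log ((N : ℝ) + 1) / 2) := by
      have h1 := le_log_primeCutoff_add_one_div_two a
      exact (hηs m).trans (Icc_subset_Icc (by linarith) (by linarith))
    rw [weilQuadratic_eq_weilFinitePrimeQuadratic (hηt m) N hwin, Complex.ofReal_re]
  -- `L¹` convergence `η_m → ξ`
  have hL2 := tendsto_integral_norm_sq_sub_of_energy hξ.1 hξ.2.1 hη' hηE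
  have hL1 : Tendsto (fun m ↦ ∫ x, ‖η m x - ξ x‖) atTop (𝓝 0) := by
    have hcs : ∀ m, (∫ x, ‖η m x - ξ x‖) ^ 2 ≤ 2 * a * ∫ x, ‖η m x - ξ x‖ ^ 2 :=
      fun m ↦ sq_integral_norm_le ((hη' m).1.sub hξ.1)
        (support_sub_subset_window (hη' m).2 hξ.2.1) ha
    have h2 : Tendsto (fun m ↦ Real.sqrt (2 * a * ∫ x, ‖η m x - ξ x‖ ^ 2)) atTop (𝓝 0) := by
      have := (hL2.const_mul (2 * a)).sqrt
      simpa using this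
    refine tendsto_of_tendsto_of_tendsto_of_le_of_le tendsto_const_nhds h2
      (fun m ↦ integral_nonneg fun _ ↦ norm_nonneg _) fun m ↦ ?_
    exact (le_abs_self _).trans (Real.abs_le_sqrt (hcs m))
  -- pointwise convergence of the transforms at every complex point
  have hpt : ∀ s : ℂ, Tendsto (fun m ↦ weilMellin (η m) s) atTop (𝓝 (weilMellin ξ s)) := by
    intro s
    rw [tendsto_iff_norm_sub_tendsto_zero]
    have hb : ∀ m, ‖weilMellin (η m) s - weilMellin ξ s‖ ≤
        Real.exp (|s.re - 1 / 2| * a) * ∫ x, ‖η m x - ξ x‖ := by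
      intro m
      rw [← weilMellin_sub_window (hη' m).1 (hη' m).2 hξ.1 hξ.2.1]
      exact norm_weilMellin_le_of_window ((hη' m).1.sub hξ.1)
        (support_sub_subset_window (hη' m).2 hξ.2.1) s
    have h0 : Tendsto (fun m ↦ Real.exp (|s.re - 1 / 2| * a) * ∫ x, ‖η m x - ξ x‖) atTop (𝓝 0) := by
      have := hL1.const_mul (Real.exp (|s.re - 1 / 2| * a))
      simpa using this
    exact tendsto_of_tendsto_of_tendsto_of_le_of_le tendsto_const_nhds h0
      (fun m ↦ norm_nonneg _) hb
  -- the truncated zero sums pass to the limit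
  set S := (weilZeroIndex_finite T).toFinset with hS
  set Pξ : ℝ := ∑ ρ' ∈ S, (riemannZetaZeroOrder ρ' : ℝ) * ‖weilMellin ξ ρ'‖ ^ 2 with hPξ
  have hPlim : Tendsto (fun m ↦ ∑ ρ' ∈ S, (riemannZetaZeroOrder ρ' : ℝ) * ‖weilMellin (η m) ρ'‖ ^ 2)
      atTop (𝓝 Pξ) :=
    tendsto_finsetSum S fun ρ' _ ↦ ((hpt ρ').norm.pow 2).const_mul _
  have hPle : ∀ m, ∑ ρ' ∈ S, (riemannZetaZeroOrder ρ' : ℝ) * ‖weilMellin (η m) ρ'‖ ^ 2 ≤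
      weilFinitePrimeQuadratic N (η m) := fun m ↦
    (sum_zeroOrder_mul_norm_sq_le_re_weilQuadratic hRH (hηt m) T).trans (hQ m).le
  have hPξ0 : Pξ ≤ 0 := le_of_tendsto_of_tendsto' hPlim hElim hPle
  -- all terms are non-negative, hence zero
  have hcrit : ∀ {ρ' : ℂ}, ρ' ∈ weilZeroIndex T → riemannZeta ρ' = 0 ∧ ρ' ≠ 1 := by
    rintro ρ' ⟨hζ, -, -, him, -⟩
    exact ⟨hζ, by rintro rfl; simp at him⟩
  have hnn : ∀ ρ' ∈ S, 0 ≤ (riemannZetaZeroOrder ρ' : ℝ) * ‖weilMellin ξ ρ'‖ ^ 2 := by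
    intro ρ' hρ'
    have hne : ρ' ≠ 1 := (hcrit ((weilZeroIndex_finite T).mem_toFinset.1 hρ')).2
    have hm0 : (0 : ℝ) ≤ riemannZetaZeroOrder ρ' := by exact_mod_cast riemannZetaZeroOrder_nonneg hne
    exact mul_nonneg hm0 (sq_nonneg _)
  have hzero := (Finset.sum_eq_zero_iff_of_nonneg hnn).1
    (le_antisymm hPξ0 (Finset.sum_nonneg hnn)) ρ ((weilZeroIndex_finite T).mem_toFinset.2 hρ)
  have hm : (0 : ℝ) < riemannZetaZeroOrder ρ := by
    exact_mod_cast (riemannZetaZeroOrder_pos_iff (hcrit hρ).2).2 (hcrit hρ).1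
  have h2 : ‖weilMellin ξ ρ‖ ^ 2 = 0 := by
    rcases mul_eq_zero.1 hzero with h | h
    · exact absurd h hm.ne'
    · exact h
  exact norm_eq_zero.1 (pow_eq_zero_iff two_ne_zero |>.1 h2)

/-- **Under RH the completed Weil form is positive definite on every window** (Yoshida 1992, Thm. 2
`⟹`, `k = ℚ`, completed-space form): if RH holds, `a > 0`, `ξ ∈ formDomain a` and `QW_λ(ξ) = 0`, then
`ξ = 0` a.e. Printed proof (pp. 321–322): `(φ,φ) = 0` ⇒ `Φ(ρ) = 0` at every non-trivial zero ⇒ `Φ`,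
entire of exponential type, vanishes identically since the distinct zeros of `ζ` are not `O(r)` — here
the last step is the tree's `Suzuki2023_lemma21_holds` (same argument), and `Φ ≡ 0` on the critical
line gives `ξ = 0` by Plancherel. [cite: Yoshida1992HermitianForms, Thm. 2 (p. 321), proof pp. 321–322] -/
theorem ae_eq_zero_of_semilocalWeilForm_eq_zero (hRH : RiemannHypothesis) (ha : 0 < a)
    {ξ : ℝ → ℂ} (hξ : ξ ∈ formDomain a) (h0 : semilocalWeilForm a ξ = 0) :
    ξ =ᵐ[volume] 0 := by
  have hE : weilFinitePrimeQuadratic (primeCutoff a) ξ = 0 := by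
    rw [semilocalWeilForm_of_mem_formDomain hξ] at h0
    exact_mod_cast h0
  have hint : Integrable ξ := integrable_of_memLp_window hξ.1 hξ.2.1
  -- the entire function `F(γ) = ξ̂(½ − iγ)`
  set F : ℂ → ℂ := fun γ ↦ weilMellin ξ (1 / 2 - I * γ) with hF
  have hFd : Differentiable ℂ F :=
    (differentiable_weilMellin_of_window hξ.1 hξ.2.1).comp (by fun_prop)
  have hFexp : ∃ C R : ℝ, ∀ z : ℂ, ‖F z‖ ≤ C * Real.exp (R * ‖z‖) := by
    refine ⟨∫ x, ‖ξ x‖, a, fun z ↦ ?_⟩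
    have h := norm_weilMellin_le_of_window hξ.1 hξ.2.1 (1 / 2 - I * z)
    have hre : |(1 / 2 - I * z).re - 1 / 2| = |z.im| := by
      simp [sub_re, mul_re]
    rw [hre] at h
    have hle : |z.im| * a ≤ a * ‖z‖ := by
      rw [mul_comm a]
      exact mul_le_mul_of_nonneg_right (Complex.abs_im_le_norm z) ha.le
    calc ‖F z‖ ≤ Real.exp (|z.im| * a) * ∫ x, ‖ξ x‖ := h
      _ ≤ Real.exp (a * ‖z‖) * ∫ x, ‖ξ x‖ :=
          mul_le_mul_of_nonneg_right (Real.exp_le_exp.2 hle) (integral_nonneg fun _ ↦ norm_nonneg _)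
      _ = (∫ x, ‖ξ x‖) * Real.exp (a * ‖z‖) := mul_comm _ _
  have hFzero : ∀ γ : ℂ, riemannXi (1 / 2 - Complex.I * γ) = 0 → F γ = 0 := by
    intro γ hγ
    set s : ℂ := 1 / 2 - I * γ with hs
    obtain ⟨hζ, h0', h1'⟩ := (riemannXi_eq_zero_iff_holds s).1 hγ
    have him : s.im ≠ 0 := im_ne_zero_of_riemannZeta_eq_zero hζ h0' h1'
    have hmem : s ∈ weilZeroIndex |s.im| := ⟨hζ, h0'.le, h1'.le, him, le_rfl⟩
    exact weilMellin_eq_zero_of_null hRH ha hξ hE hmem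
  have hF0 : ∀ z, F z = 0 := Suzuki2023_lemma21_holds F hFd hFexp 0 hFzero
  -- the transform vanishes on the critical line, so `ξ = 0` in `L²`
  have hline : ∀ t : ℝ, weilMellin ξ (1 / 2 + t * I) = 0 := by
    intro t
    have h := hF0 (-(t : ℂ))
    simp only [hF] at h
    rwa [show (1 / 2 : ℂ) - I * -(t : ℂ) = 1 / 2 + t * I by ring] at h
  have hPl := integral_norm_sq_weilMellin_half_line_of_memLp hint hξ.1
  have h0int : ∫ x, ‖ξ x‖ ^ 2 = 0 := by
    have e0 : (fun t : ℝ ↦ ‖weilMellin ξ (1 / 2 + t * I)‖ ^ 2) = fun _ ↦ (0 : ℝ) := by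
      funext t; rw [hline t]; simp
    have : ∫ t : ℝ, ‖weilMellin ξ (1 / 2 + t * I)‖ ^ 2 = 0 := by
      rw [e0, integral_zero]
    rw [this] at hPl
    have hn : 0 ≤ ∫ x, ‖ξ x‖ ^ 2 := integral_nonneg fun x ↦ by positivity
    nlinarith [Real.pi_pos, hn]
  have hae : (fun x ↦ ‖ξ x‖ ^ 2) =ᵐ[volume] 0 :=
    (integral_eq_zero_iff_of_nonneg (fun x ↦ by positivity) (integrable_norm_sq_of_memLp hξ.1)).1 h0int
  filter_upwards [hae] with x hx
  simpa using hx

end PositiveDefinite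

/-! ## F. Ground states: the lower bound of `QW_λ` is attained on the form domain (RH-free) -/

section GroundState

/-- The set of values of the extended form on the `L²`-unit sphere of `Dom(QW_λ)` is nonempty for `a > 0`
(it contains the values at normalised test functions of the window). [cite: ConnesConsani2023, Prop. 2.1 (the domain contains the smooth functions supported in the window), p. 103] -/
theorem formDomain_values_nonempty (ha : 0 < a) :
    {x : ℝ | ∃ ξ ∈ formDomain a, ∫ t, ‖ξ t‖ ^ 2 = (1 : ℝ) ∧
      x = weilFinitePrimeQuadratic (primeCutoff a) ξ}.Nonempty := by
  obtain ⟨g, hg, hs, hn⟩ := exists_isWeilTest_sphere ha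
  exact ⟨_, g, mem_formDomain_of_isWeilTest hg hs, hn, rfl⟩

/-- Near-minimisers of the extended form exist in the unit sphere of the form domain. [cite: ConnesConsani2023, Cor. 2.4 with p. 102 (the lower bound of QW_λ), pp. 102–106] -/
theorem exists_lt_formLowerBound_add (ha : 0 < a) {ε : ℝ} (hε : 0 < ε) :
    ∃ ξ ∈ formDomain a, ∫ t, ‖ξ t‖ ^ 2 = (1 : ℝ) ∧
      weilFinitePrimeQuadratic (primeCutoff a) ξ < formLowerBound a + ε := by
  have h : sInf {x : ℝ | ∃ ξ ∈ formDomain a, ∫ t, ‖ξ t‖ ^ 2 = (1 : ℝ) ∧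
      x = weilFinitePrimeQuadratic (primeCutoff a) ξ} < formLowerBound a + ε :=
    lt_add_of_pos_right _ hε
  obtain ⟨x, ⟨ξ, hξ, hn, rfl⟩, hlt⟩ := exists_lt_of_csInf_lt (formDomain_values_nonempty ha) h
  exact ⟨ξ, hξ, hn, hlt⟩

/-- **Bombieri 2000, Thm. 3 (one window): the lower bound of `QW_λ` is a minimum — a ground state exists
in `Dom(QW_λ)`.** "Let `𝓔` be a finite union of closed finite intervals in `(0, ∞)`. Then the infimum of
`T[f ∗ f̄*]` in the unit sphere of the space `L²(𝓔)` of `L²`-functions with compact support in `𝓔` is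
attained" — here for `𝓔 = [e^{−a}, e^{a}]` in the additive variable, with the functional extended to `L²` as
the tree's `semilocalWeilForm` (finite exactly on `formDomain a`): for every window `a > 0` there is
`ξ ∈ Dom(QW_λ)`, `‖ξ‖₂ = 1`, with `E(ξ) = formLowerBound a`.  The printed road: a minimising sequence has
bounded energy ((4.4); here the coercivity `exists_energy_le`), hence an `L²`-convergent subsequence (p. 196,
Taylor coefficients + tails; here the Rellich lemma `exists_subseq_tendsto_of_energy_le`); the limit has
norm one and minimises by lower semicontinuity ((4.6); here `prop_2_1`).  RH-free.
[cite: Bombieri2000Weil, §4 Thm. 3 (p. 196); ConnesConsani2023, Prop. 2.1 and Cor. 2.4 (the lower bound of QW_λ), pp. 102–106] -/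
theorem exists_ground_state (ha : 0 < a) :
    ∃ ξ ∈ formDomain a, ∫ t, ‖ξ t‖ ^ 2 = (1 : ℝ) ∧
      weilFinitePrimeQuadratic (primeCutoff a) ξ = formLowerBound a := by
  -- a minimising sequence
  have hmin : ∀ n : ℕ, ∃ ξ ∈ formDomain a, ∫ t, ‖ξ t‖ ^ 2 = (1 : ℝ) ∧
      weilFinitePrimeQuadratic (primeCutoff a) ξ < formLowerBound a + 1 / ((n : ℝ) + 1) :=
    fun n ↦ exists_lt_formLowerBound_add ha (by positivity)
  choose u huD hu1 hult using hmin
  -- bounded energy along the sequence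
  obtain ⟨C, hC⟩ := exists_energy_le ha (primeCutoff a)
  have hE : ∀ n, (logSobolevEnergy (u n)).toReal ≤ 4 * π * (formLowerBound a + 1) + C := by
    intro n
    have h1 := hC (u n) (huD n)
    rw [hu1 n, mul_one] at h1
    have h2 : weilFinitePrimeQuadratic (primeCutoff a) (u n) ≤ formLowerBound a + 1 := by
      have : 1 / ((n : ℝ) + 1) ≤ 1 := by
        rw [div_le_one (by positivity)]; linarith [(Nat.cast_nonneg n : (0 : ℝ) ≤ n)]
      linarith [hult n]
    have h3 : 4 * π * weilFinitePrimeQuadratic (primeCutoff a) (u n) ≤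
        4 * π * (formLowerBound a + 1) := mul_le_mul_of_nonneg_left h2 (by positivity)
    linarith
  -- Rellich: an `L²`-convergent subsequence
  obtain ⟨ξ, hξm, hξs, φ, hφ, hconv⟩ := exists_subseq_tendsto_of_energy_le ha huD
    (fun n ↦ (hu1 n).le) hE
  have huφ : ∀ j, MemLp (u (φ j)) 2 volume ∧ Function.support (u (φ j)) ⊆ Icc (-a) a :=
    fun j ↦ ⟨(huD (φ j)).1, (huD (φ j)).2.1⟩
  -- the limit is a unit vector
  have hξ1 : ∫ x, ‖ξ x‖ ^ 2 = 1 := by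
    have h := tendsto_integral_norm_sq_of_tendsto_sub hξm (fun j ↦ (huφ j).1) hconv
    have e : (fun j ↦ ∫ x, ‖u (φ j) x‖ ^ 2) = fun _ ↦ (1 : ℝ) := funext fun j ↦ hu1 (φ j)
    rw [e] at h
    exact tendsto_nhds_unique h tendsto_const_nhds
  -- lower semicontinuity: `QW(ξ) ≤ liminf QW(u_{φ j}) ≤ formLowerBound a + 1/(m+1)` for every `m`
  have hlsc := semilocalWeilForm_le_liminf ha hξm hξs huφ hconv
  have hbound : ∀ m : ℕ, liminf (fun j ↦ semilocalWeilForm a (u (φ j))) atTop ≤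
      (((formLowerBound a + 1 / ((m : ℝ) + 1) : ℝ)) : EReal) := by
    intro m
    refine Filter.liminf_le_of_frequently_le (Filter.Eventually.frequently ?_)
    refine Filter.eventually_atTop.2 ⟨m, fun j hj ↦ ?_⟩
    rw [semilocalWeilForm_of_mem_formDomain (huD (φ j))]
    have hφj : (m : ℝ) + 1 ≤ (φ j : ℝ) + 1 := by
      exact_mod_cast Nat.add_le_add_right (hj.trans (hφ.id_le j)) 1
    have h2 : 1 / ((φ j : ℝ) + 1) ≤ 1 / ((m : ℝ) + 1) :=
      one_div_le_one_div_of_le (by positivity) hφj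
    have h3 : weilFinitePrimeQuadratic (primeCutoff a) (u (φ j)) ≤
        formLowerBound a + 1 / ((m : ℝ) + 1) := by linarith [hult (φ j)]
    exact_mod_cast h3
  -- hence finite energy, membership in the domain, and minimality
  have hlt_top : semilocalWeilForm a ξ < ⊤ :=
    lt_of_le_of_lt (hlsc.trans (hbound 0)) (EReal.coe_lt_top _)
  have hξE : logSobolevEnergy ξ < ∞ := by
    by_contra h
    exact hlt_top.ne (semilocalWeilForm_of_not_lt_top h)
  have hξD : ξ ∈ formDomain a := ⟨hξm, hξs, hξE⟩
  have hle : weilFinitePrimeQuadratic (primeCutoff a) ξ ≤ formLowerBound a := by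
    refine le_of_forall_pos_le_add fun ε hε ↦ ?_
    obtain ⟨m, hm⟩ := exists_nat_one_div_lt hε
    have h := hlsc.trans (hbound m)
    rw [semilocalWeilForm_of_mem_formDomain hξD, EReal.coe_le_coe_iff] at h
    linarith
  exact ⟨ξ, hξD, hξ1, le_antisymm hle (formLowerBound_le hξD hξ1 (bddBelow_formDomain_values ha))⟩

/-- On test functions of the window the value of the extended form is `Re Q`. [cite: ConnesConsani2023, Prop. 2.1 eq. (2.11), p. 103] -/
theorem weilFinitePrimeQuadratic_eq_re_weilQuadratic_of_isWeilTest {g : ℝ → ℂ} (hg : IsWeilTest g)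
    (hs : tsupport g ⊆ Icc (-a) a) :
    weilFinitePrimeQuadratic (primeCutoff a) g = (weilQuadratic g).re := by
  have hwin : tsupport g ⊆ Icc (-(Real.log ((primeCutoff a : ℝ) + 1) / 2))
      (Real.log ((primeCutoff a : ℝ) + 1) / 2) :=
    hs.trans (Icc_subset_Icc (neg_le_neg (le_log_primeCutoff_add_one_div_two a))
      (le_log_primeCutoff_add_one_div_two a))
  rw [weilQuadratic_eq_weilFinitePrimeQuadratic hg (primeCutoff a) hwin, Complex.ofReal_re]

/-- `formLowerBound a ≤ ε(a)`: test functions of the window are unit vectors of the form domain on which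
the extended form is `Re Q`. [cite: ConnesConsani2023, proof of Lemma 2.2, eqs. (2.15)–(2.16) (C_c^∞((−a, a)) is a form core), p. 105] -/
theorem formLowerBound_le_weilGroundEnergy (ha : 0 < a) : formLowerBound a ≤ weilGroundEnergy a := by
  obtain ⟨g₀, hg₀, hs₀, hn₀⟩ := exists_isWeilTest_sphere ha
  refine le_csInf ⟨_, g₀, hg₀, hs₀, hn₀, rfl⟩ ?_
  rintro x ⟨g, hg, hs, hn, rfl⟩
  rw [← weilFinitePrimeQuadratic_eq_re_weilQuadratic_of_isWeilTest hg hs]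
  exact formLowerBound_le (mem_formDomain_of_isWeilTest hg hs) hn (bddBelow_formDomain_values ha)

/-- `ε(a) ≤ E(ξ)` for every unit vector `ξ` of the form domain: approximate `ξ` by test functions in the
graph norm (`exists_seq_C_tendsto_energy`), along which `E` and the `L²`-norm converge, and use
homogeneity `ε(a)‖η‖² ≤ Re Q(η) = E(η)` (`ConnesVanSuijlekom.weilGroundEnergy_mul_le_re`). [cite: ConnesConsani2023, proof of Lemma 2.2, eqs. (2.15)–(2.18), p. 105] -/
theorem weilGroundEnergy_le_weilFinitePrimeQuadratic (ha : 0 < a) {ξ : ℝ → ℂ}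
    (hξ : ξ ∈ formDomain a) (hn : ∫ t, ‖ξ t‖ ^ 2 = (1 : ℝ)) :
    weilGroundEnergy a ≤ weilFinitePrimeQuadratic (primeCutoff a) ξ := by
  obtain ⟨η, hηC, hηE⟩ := exists_seq_C_tendsto_energy ha hξ
  have hηt : ∀ m, IsWeilTest (η m) := fun m ↦ (Yoshida1992.mem_C.1 (hηC m)).1
  have hηs : ∀ m, tsupport (η m) ⊆ Icc (-a) a := fun m ↦ (Yoshida1992.mem_C.1 (hηC m)).2
  have hηD : ∀ m, η m ∈ formDomain a := fun m ↦ mem_formDomain_of_isWeilTest (hηt m) (hηs m)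
  -- `E(η_m) → E(ξ)` and `‖η_m‖₂² → 1`
  have hlimE := tendsto_weilFinitePrimeQuadratic_of_energy ha hξ hηD hηE (primeCutoff a)
  have hL2 : Tendsto (fun m ↦ ∫ x, ‖η m x - ξ x‖ ^ 2) atTop (𝓝 0) :=
    tendsto_integral_norm_sq_sub_of_energy hξ.1 hξ.2.1 (fun m ↦ ⟨(hηD m).1, (hηD m).2.1⟩) hηE
  have hlimN : Tendsto (fun m ↦ ∫ x, ‖η m x‖ ^ 2) atTop (𝓝 1) := by
    have h := tendsto_integral_norm_sq_of_tendsto_sub hξ.1 (fun m ↦ (hηD m).1) hL2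
    rwa [hn] at h
  have hhom : ∀ m, weilGroundEnergy a * ∫ x, ‖η m x‖ ^ 2 ≤
      weilFinitePrimeQuadratic (primeCutoff a) (η m) := by
    intro m
    rw [weilFinitePrimeQuadratic_eq_re_weilQuadratic_of_isWeilTest (hηt m) (hηs m)]
    exact ConnesVanSuijlekom.weilGroundEnergy_mul_le_re (hηt m) (hηs m)
  have hlim2 : Tendsto (fun m ↦ weilGroundEnergy a * ∫ x, ‖η m x‖ ^ 2) atTop
      (𝓝 (weilGroundEnergy a * 1)) := hlimN.const_mul _
  rw [mul_one] at hlim2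
  exact le_of_tendsto_of_tendsto hlim2 hlimE (Eventually.of_forall hhom)

/-- **The lower bound of `QW_λ` over its form domain equals the ground energy `ε(a)` over test
functions** (`C_c^∞((−a, a))` is a form core: the middle step (2.15)–(2.16) of the printed proof of
Lemma 2.2).  This identifies `ConnesConsani2023.formLowerBound` with the tree's `weilGroundEnergy`.
[cite: ConnesConsani2023, proof of Lemma 2.2, eqs. (2.15)–(2.16), p. 105; Bombieri2000Weil, §4 Problem 2 (p. 194)] -/
theorem formLowerBound_eq_weilGroundEnergy (ha : 0 < a) : formLowerBound a = weilGroundEnergy a := by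
  refine le_antisymm (formLowerBound_le_weilGroundEnergy ha) (le_csInf (formDomain_values_nonempty ha) ?_)
  rintro x ⟨ξ, hξ, hn, rfl⟩
  exact weilGroundEnergy_le_weilFinitePrimeQuadratic ha hξ hn

end GroundState

/-! ## G. The radical is Weil-orthogonal to the window's test functions (zero-side form) -/

section Radical

/-- Sesquilinear expansion of `Q` on test functions:
`Q(u + c h) = Q(u) + c̄ W(u ⋆ h̃) + c W(h ⋆ ũ) + |c|² Q(h)`. [cite: Bombieri2000Weil, §4 (T[f ∗ f̄*] is a hermitian form in f); Yoshida1992HermitianForms, §2] -/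
theorem weilQuadratic_add_const_mul {u h : ℝ → ℂ} (hu : IsWeilTest u) (hh : IsWeilTest h) (c : ℂ) :
    weilQuadratic (u + fun x ↦ c * h x) =
      weilQuadratic u + conj c * weilFunctional (weilConv u (weilReflect h)) +
        c * weilFunctional (weilConv h (weilReflect u)) + (Complex.normSq c : ℂ) * weilQuadratic h := by
  have hch : IsWeilTest (fun x ↦ c * h x) := hh.const_mul c
  have hur : IsWeilTest (weilReflect u) := hu.weilReflect
  have hhr : IsWeilTest (weilReflect h) := hh.weilReflect
  have hchr : IsWeilTest (weilReflect fun x ↦ c * h x) := hch.weilReflect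
  unfold weilQuadratic
  rw [weilReflect_add, weilConv_add_left hu hch (hur.add hchr), weilConv_add_right hu hur hchr,
    weilConv_add_right hch hur hchr]
  rw [weilFunctional_add ((hu.weilConv hur).add (hu.weilConv hchr))
      ((hch.weilConv hur).add (hch.weilConv hchr)),
    weilFunctional_add (hu.weilConv hur) (hu.weilConv hchr),
    weilFunctional_add (hch.weilConv hur) (hch.weilConv hchr)]
  rw [weilReflect_const_mul, weilConv_const_mul_right, weilConv_const_mul_left,
    weilConv_const_mul_left, weilConv_const_mul_right, weilFunctional_const_mul,
    weilFunctional_const_mul]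
  have e : (fun t ↦ c * (conj c * weilConv h (weilReflect h) t)) =
      fun t ↦ (Complex.normSq c : ℂ) * weilConv h (weilReflect h) t := by
    funext t; rw [← mul_assoc, Complex.mul_conj]
  rw [e, weilFunctional_const_mul]
  ring

/-- Hermitian symmetry of Weil's form on test functions: `W(h ⋆ ũ) = conj W(u ⋆ h̃)` (from the
reality of `Q`, `weilQuadratic_im_holds`, by polarisation). [cite: Bombieri2000Weil, §2 (reality of the explicit-formula functional on self-adjoint kernels); Yoshida1992HermitianForms, §2 (( , ) is hermitian)] -/
theorem weilForm_conj_symm {u h : ℝ → ℂ} (hu : IsWeilTest u) (hh : IsWeilTest h) :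
    weilFunctional (weilConv h (weilReflect u)) = conj (weilFunctional (weilConv u (weilReflect h))) := by
  set x := weilFunctional (weilConv u (weilReflect h)) with hx
  set y := weilFunctional (weilConv h (weilReflect u)) with hy
  have h1 : (weilQuadratic (u + fun t ↦ (1 : ℂ) * h t)).im = 0 :=
    weilQuadratic_im_holds (hu.add (hh.const_mul 1))
  have hi : (weilQuadratic (u + fun t ↦ I * h t)).im = 0 :=
    weilQuadratic_im_holds (hu.add (hh.const_mul I))
  rw [weilQuadratic_add_const_mul hu hh] at h1 hi
  have hu0 : (weilQuadratic u).im = 0 := weilQuadratic_im_holds hu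
  have hh0 : (weilQuadratic h).im = 0 := weilQuadratic_im_holds hh
  simp only [← hx, ← hy, add_im, mul_im, map_one, one_re, one_im, Complex.conj_I, neg_re, neg_im,
    I_re, I_im, Complex.normSq_I, ofReal_one, hu0, hh0] at h1 hi
  apply Complex.ext
  · simp only [conj_re]; linarith
  · simp only [conj_im]; linarith

/-- The explicit formula for a product kernel: for test functions `u`, `h`,
`W(u ⋆ h̃) = Σ_ρ m(ρ) û(ρ) conj ĥ(1 − ρ̄)`, absolutely convergent sum over the non-trivial zeros
(`explicit_formula_holds`, `(u ⋆ h̃)^(s) = û(s) conj ĥ(1 − s̄)`).  (The summit tree has the same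
statement as `Summit.RiemannHypothesis.RiemannHypothesis.Theorems.GroundStatesConvergeToXi.hasSum_zeroSide_weilConv_weilReflect`,
which `Literature/` cannot import; kept private here.) [cite: Bombieri2000Weil, §2 Thm. 2 (explicit formula) with §3 eq. (3.2)] -/
private theorem hasSum_zeroSide_weilForm {u h : ℝ → ℂ} (hu : IsWeilTest u) (hh : IsWeilTest h) :
    HasSum (fun ρ : ZetaZeros.riemannZetaNontrivialZeros ↦
      (riemannZetaZeroOrder (ρ : ℂ) : ℂ) *
        (weilMellin u ρ * conj (weilMellin h (1 - conj (ρ : ℂ)))))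
      (weilFunctional (weilConv u (weilReflect h))) := by
  have hk : IsWeilTest (weilConv u (weilReflect h)) := hu.weilConv hh.weilReflect
  have hsum := summable_norm_zeroSide hk
  have heq : (∑' ρ : ZetaZeros.riemannZetaNontrivialZeros,
      (riemannZetaZeroOrder (ρ : ℂ) : ℂ) * weilMellin (weilConv u (weilReflect h)) ρ) =
      weilFunctional (weilConv u (weilReflect h)) :=
    tendsto_nhds_unique (hasWeilZeroSide_tsum hsum) (explicit_formula_holds hk)
  have hmel : ∀ s : ℂ, weilMellin (weilConv u (weilReflect h)) s =
      weilMellin u s * conj (weilMellin h (1 - conj s)) := fun s ↦ by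
    rw [weilMellin_weilConv_holds hu.1.continuous hu.2 hh.weilReflect.1.continuous hh.weilReflect.2,
      weilMellin_weilReflect_holds]
  have h := hsum.of_norm.hasSum
  rw [heq] at h
  refine h.congr_fun fun ρ ↦ ?_
  rw [hmel]

/-- For a window function `ξ ∈ L²`, `supp ξ ⊆ [−a, a]`, and a test function `h`, the zero-side
pairing `Σ_ρ m(ρ) ξ̂(ρ) conj ĥ(1 − ρ̄)` converges absolutely (`|ξ̂| ≤ e^{a/2}‖ξ‖₁` in the strip,
`|ĥ(s)| ≪ (1 + (Im s)²)⁻²`). [cite: Bombieri2000Weil, §2 (convergence of the zero side); ConnesConsani2023, §2] -/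
theorem summable_norm_zeroSide_window {ξ h : ℝ → ℂ} (hξm : MemLp ξ 2 volume)
    (hξs : Function.support ξ ⊆ Icc (-a) a) (ha : 0 ≤ a) (hh : IsWeilTest h) :
    Summable fun ρ : ZetaZeros.riemannZetaNontrivialZeros ↦
      ‖(riemannZetaZeroOrder (ρ : ℂ) : ℂ) *
        (weilMellin ξ ρ * conj (weilMellin h (1 - conj (ρ : ℂ))))‖ := by
  refine summable_norm_zeroSide_of_le
    (a := fun s ↦ weilMellin ξ s * conj (weilMellin h (1 - conj s)))
    (K := Real.exp (a / 2) * (∫ x, ‖ξ x‖) * weilDecayW2 (1 / 2) h) fun ρ hρ ↦ ?_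
  have h0 := ZetaZeros.riemannZetaNontrivialZeros.re_pos hρ
  have h1 := ZetaZeros.riemannZetaNontrivialZeros.re_lt_one hρ
  have hξb : ‖weilMellin ξ ρ‖ ≤ Real.exp (a / 2) * ∫ x, ‖ξ x‖ := by
    refine (norm_weilMellin_le_of_window hξm hξs ρ).trans ?_
    refine mul_le_mul_of_nonneg_right (Real.exp_le_exp.2 ?_) (integral_nonneg fun _ ↦ norm_nonneg _)
    have : |ρ.re - 1 / 2| ≤ 1 / 2 := abs_le.2 ⟨by linarith, by linarith⟩
    nlinarith
  have hre : |(1 - conj ρ).re - 1 / 2| ≤ 1 / 2 := by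
    simp only [sub_re, one_re, conj_re]
    exact abs_le.2 ⟨by linarith, by linarith⟩
  have hhb := norm_weilMellin_le_sq hh hre
  have him : (1 - conj ρ).im = ρ.im := by simp
  rw [him] at hhb
  rw [norm_mul, Complex.norm_conj]
  have hK : 0 ≤ Real.exp (a / 2) * ∫ x, ‖ξ x‖ := by positivity
  calc ‖weilMellin ξ ρ‖ * ‖weilMellin h (1 - conj ρ)‖
      ≤ (Real.exp (a / 2) * ∫ x, ‖ξ x‖) * (weilDecayW2 (1 / 2) h / (1 + ρ.im ^ 2) ^ 2) :=
        mul_le_mul hξb hhb (norm_nonneg _) hK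
    _ = Real.exp (a / 2) * (∫ x, ‖ξ x‖) * weilDecayW2 (1 / 2) h / (1 + ρ.im ^ 2) ^ 2 := by ring

/-- A window function whose transform vanishes at every non-trivial zero of `ζ` is `0` a.e.:
`ξ̂` is entire of exponential type (`differentiable_weilMellin_of_window`), so it vanishes identically
by the tree's `Suzuki2023_lemma21_holds` (the distinct zeros of `ζ` are not `O(r)`), and Plancherel.
RH-free. [cite: Yoshida1992HermitianForms, proof of Thm. 2, pp. 321–322; Suzuki2023, Lemma 2.1] -/
theorem ae_eq_zero_of_weilMellin_eq_zero_on_zeros (ha : 0 < a) {ξ : ℝ → ℂ} (hξm : MemLp ξ 2 volume)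
    (hξs : Function.support ξ ⊆ Icc (-a) a)
    (hz : ∀ ρ ∈ ZetaZeros.riemannZetaNontrivialZeros, weilMellin ξ ρ = 0) :
    ξ =ᵐ[volume] 0 := by
  have hint : Integrable ξ := integrable_of_memLp_window hξm hξs
  set F : ℂ → ℂ := fun γ ↦ weilMellin ξ (1 / 2 - I * γ) with hF
  have hFd : Differentiable ℂ F :=
    (differentiable_weilMellin_of_window hξm hξs).comp (by fun_prop)
  have hFexp : ∃ C R : ℝ, ∀ z : ℂ, ‖F z‖ ≤ C * Real.exp (R * ‖z‖) := by
    refine ⟨∫ x, ‖ξ x‖, a, fun z ↦ ?_⟩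
    have h := norm_weilMellin_le_of_window hξm hξs (1 / 2 - I * z)
    have hre : |(1 / 2 - I * z).re - 1 / 2| = |z.im| := by
      simp [sub_re, mul_re]
    rw [hre] at h
    have hle : |z.im| * a ≤ a * ‖z‖ := by
      rw [mul_comm a]
      exact mul_le_mul_of_nonneg_right (Complex.abs_im_le_norm z) ha.le
    calc ‖F z‖ ≤ Real.exp (|z.im| * a) * ∫ x, ‖ξ x‖ := h
      _ ≤ Real.exp (a * ‖z‖) * ∫ x, ‖ξ x‖ :=
          mul_le_mul_of_nonneg_right (Real.exp_le_exp.2 hle) (integral_nonneg fun _ ↦ norm_nonneg _)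
      _ = (∫ x, ‖ξ x‖) * Real.exp (a * ‖z‖) := mul_comm _ _
  have hFzero : ∀ γ : ℂ, riemannXi (1 / 2 - Complex.I * γ) = 0 → F γ = 0 := fun γ hγ ↦
    hz _ (mem_riemannZetaNontrivialZeros_of_riemannXi_eq_zero hγ)
  have hF0 : ∀ z, F z = 0 := Suzuki2023_lemma21_holds F hFd hFexp 0 hFzero
  have hline : ∀ t : ℝ, weilMellin ξ (1 / 2 + t * I) = 0 := by
    intro t
    have h := hF0 (-(t : ℂ))
    simp only [hF] at h
    rwa [show (1 / 2 : ℂ) - I * -(t : ℂ) = 1 / 2 + t * I by ring] at h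
  have hPl := integral_norm_sq_weilMellin_half_line_of_memLp hint hξm
  have h0int : ∫ x, ‖ξ x‖ ^ 2 = 0 := by
    have e0 : (fun t : ℝ ↦ ‖weilMellin ξ (1 / 2 + t * I)‖ ^ 2) = fun _ ↦ (0 : ℝ) := by
      funext t; rw [hline t]; simp
    have : ∫ t : ℝ, ‖weilMellin ξ (1 / 2 + t * I)‖ ^ 2 = 0 := by
      rw [e0, integral_zero]
    rw [this] at hPl
    have hn : 0 ≤ ∫ x, ‖ξ x‖ ^ 2 := integral_nonneg fun x ↦ by positivity
    nlinarith [Real.pi_pos, hn]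
  have hae : (fun x ↦ ‖ξ x‖ ^ 2) =ᵐ[volume] 0 :=
    (integral_eq_zero_iff_of_nonneg (fun x ↦ by positivity) (integrable_norm_sq_of_memLp hξm)).1 h0int
  filter_upwards [hae] with x hx
  simpa using hx

/-- **The radical is Weil-orthogonal to the window, zero-side form.** If the completed form is
`≥ 0` on the window `[−a, a]` (Weil positivity there) and `ξ₀ ∈ Dom(QW_λ)` is a null vector,
`E(ξ₀) = 0`, then for every test function `h` supported in `[−a, a]`
`Σ_ρ m(ρ) ξ̂₀(ρ) conj ĥ(1 − ρ̄) = 0` (absolutely convergent sum over the non-trivial zeros).  Proof: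
test functions `η_m → ξ₀` in the graph norm (`exists_seq_C_tendsto_energy`); `Re Q(η_m + c h) ≥ 0`,
expanded sesquilinearly (`weilQuadratic_add_const_mul`, `weilForm_conj_symm`); `Q(η_m) → E(ξ₀) = 0`,
and `W(η_m ⋆ h̃) = Σ_ρ m(ρ) η̂_m(ρ) conj ĥ(1−ρ̄) → Σ_ρ m(ρ) ξ̂₀(ρ) conj ĥ(1−ρ̄)` (uniform convergence
of `η̂_m` on the strip against the summable majorant); the limit inequality
`0 ≤ 2 Re(c̄ Z) + |c|² Re Q(h)` for all `c ∈ ℂ` forces `Z = 0`.  (This is the relation behind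
Suzuki's null series, J. Lond. Math. Soc. 108 (2023) Thm. 6.1/§6.2, at the level of Yoshida's
completed space.) [cite: Yoshida1992HermitianForms, Thm. 2 and its proof, pp. 321–322; Suzuki2023, §6.2 (p. 16)] -/
theorem hasSum_zeroSide_radical (ha : 0 < a) (hpos : WeilPositivityOn a) {ξ₀ : ℝ → ℂ}
    (hξ₀ : ξ₀ ∈ formDomain a) (h0 : weilFinitePrimeQuadratic (primeCutoff a) ξ₀ = 0)
    {h : ℝ → ℂ} (hh : IsWeilTest h) (hhs : tsupport h ⊆ Icc (-a) a) :
    HasSum (fun ρ : ZetaZeros.riemannZetaNontrivialZeros ↦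
      (riemannZetaZeroOrder (ρ : ℂ) : ℂ) *
        (weilMellin ξ₀ ρ * conj (weilMellin h (1 - conj (ρ : ℂ))))) 0 := by
  have hsum := summable_norm_zeroSide_window hξ₀.1 hξ₀.2.1 ha.le hh
  set Z : ℂ := ∑' ρ : ZetaZeros.riemannZetaNontrivialZeros,
    (riemannZetaZeroOrder (ρ : ℂ) : ℂ) * (weilMellin ξ₀ ρ * conj (weilMellin h (1 - conj (ρ : ℂ))))
    with hZdef
  suffices hZ0 : Z = 0 by
    have h := hsum.of_norm.hasSum
    rwa [← hZdef, hZ0] at h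
  -- density of `C(a)` in the graph norm
  obtain ⟨η, hηC, hηE⟩ := exists_seq_C_tendsto_energy ha hξ₀
  have hηt : ∀ m, IsWeilTest (η m) := fun m ↦ (Yoshida1992.mem_C.1 (hηC m)).1
  have hηs : ∀ m, tsupport (η m) ⊆ Icc (-a) a := fun m ↦ (Yoshida1992.mem_C.1 (hηC m)).2
  have hηD : ∀ m, η m ∈ formDomain a := fun m ↦ mem_formDomain_of_isWeilTest (hηt m) (hηs m)
  -- `L¹` convergence `∫|η_m − ξ₀| → 0`
  have hL2 : Tendsto (fun m ↦ ∫ x, ‖η m x - ξ₀ x‖ ^ 2) atTop (𝓝 0) :=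
    tendsto_integral_norm_sq_sub_of_energy hξ₀.1 hξ₀.2.1 (fun m ↦ ⟨(hηD m).1, (hηD m).2.1⟩) hηE
  have hL1 : Tendsto (fun m ↦ ∫ x, ‖η m x - ξ₀ x‖) atTop (𝓝 0) := by
    have hcs : ∀ m, (∫ x, ‖η m x - ξ₀ x‖) ^ 2 ≤ 2 * a * ∫ x, ‖η m x - ξ₀ x‖ ^ 2 :=
      fun m ↦ sq_integral_norm_le ((hηD m).1.sub hξ₀.1)
        (support_sub_subset_window (hηD m).2.1 hξ₀.2.1) ha
    have h2 : Tendsto (fun m ↦ Real.sqrt (2 * a * ∫ x, ‖η m x - ξ₀ x‖ ^ 2)) atTop (𝓝 0) := by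
      have := (hL2.const_mul (2 * a)).sqrt
      simpa using this
    refine tendsto_of_tendsto_of_tendsto_of_le_of_le tendsto_const_nhds h2
      (fun m ↦ integral_nonneg fun _ ↦ norm_nonneg _) fun m ↦ ?_
    exact (le_abs_self _).trans (Real.abs_le_sqrt (hcs m))
  -- the summable majorant `S = Σ_ρ m(ρ) |ĥ(1 − ρ̄)|`
  have hmaj : Summable fun ρ : ZetaZeros.riemannZetaNontrivialZeros ↦
      ‖(riemannZetaZeroOrder (ρ : ℂ) : ℂ) * conj (weilMellin h (1 - conj (ρ : ℂ)))‖ := by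
    refine summable_norm_zeroSide_of_le (a := fun s ↦ conj (weilMellin h (1 - conj s)))
      (K := weilDecayW2 (1 / 2) h) fun ρ hρ ↦ ?_
    have h0 := ZetaZeros.riemannZetaNontrivialZeros.re_pos hρ
    have h1 := ZetaZeros.riemannZetaNontrivialZeros.re_lt_one hρ
    have hre : |(1 - conj ρ).re - 1 / 2| ≤ 1 / 2 := by
      simp only [sub_re, one_re, conj_re]
      exact abs_le.2 ⟨by linarith, by linarith⟩
    have hhb := norm_weilMellin_le_sq hh hre
    have him : (1 - conj ρ).im = ρ.im := by simp
    rw [him] at hhb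
    rwa [Complex.norm_conj]
  set S : ℝ := ∑' ρ : ZetaZeros.riemannZetaNontrivialZeros,
    ‖(riemannZetaZeroOrder (ρ : ℂ) : ℂ) * conj (weilMellin h (1 - conj (ρ : ℂ)))‖ with hS
  -- `W(η_m ⋆ h̃) → Z`
  have hB : Tendsto (fun m ↦ weilFunctional (weilConv (η m) (weilReflect h))) atTop (𝓝 Z) := by
    rw [tendsto_iff_norm_sub_tendsto_zero]
    have hbound : ∀ m, ‖weilFunctional (weilConv (η m) (weilReflect h)) - Z‖ ≤
        Real.exp (a / 2) * (∫ x, ‖η m x - ξ₀ x‖) * S := by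
      intro m
      have hηsum := (hasSum_zeroSide_weilForm (hηt m) hh)
      rw [← hηsum.tsum_eq, hZdef, ← (hηsum.summable).tsum_sub hsum.of_norm]
      have hS' : HasSum (fun ρ : ZetaZeros.riemannZetaNontrivialZeros ↦
          Real.exp (a / 2) * (∫ x, ‖η m x - ξ₀ x‖) *
            ‖(riemannZetaZeroOrder (ρ : ℂ) : ℂ) * conj (weilMellin h (1 - conj (ρ : ℂ)))‖)
          (Real.exp (a / 2) * (∫ x, ‖η m x - ξ₀ x‖) * S) :=
        hmaj.hasSum.mul_left _
      refine tsum_of_norm_bounded hS' fun ρ ↦ ?_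
      have hρ := ρ.2
      have h0' := ZetaZeros.riemannZetaNontrivialZeros.re_pos hρ
      have h1' := ZetaZeros.riemannZetaNontrivialZeros.re_lt_one hρ
      rw [← mul_sub, ← sub_mul, ← weilMellin_sub_window (hηD m).1 (hηD m).2.1 hξ₀.1 hξ₀.2.1,
        norm_mul, norm_mul, norm_mul, mul_left_comm]
      refine mul_le_mul_of_nonneg_right ?_ (by positivity)
      refine (norm_weilMellin_le_of_window ((hηD m).1.sub hξ₀.1)
        (support_sub_subset_window (hηD m).2.1 hξ₀.2.1) ρ).trans ?_
      refine mul_le_mul_of_nonneg_right (Real.exp_le_exp.2 ?_) (integral_nonneg fun _ ↦ norm_nonneg _)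
      have : |(ρ : ℂ).re - 1 / 2| ≤ 1 / 2 := abs_le.2 ⟨by linarith, by linarith⟩
      nlinarith
    have h0lim : Tendsto (fun m ↦ Real.exp (a / 2) * (∫ x, ‖η m x - ξ₀ x‖) * S) atTop (𝓝 0) := by
      have := (hL1.const_mul (Real.exp (a / 2))).mul_const S
      simpa using this
    exact squeeze_zero (fun m ↦ norm_nonneg _) hbound h0lim
  -- positivity on the window, expanded: `0 ≤ Re Q(η_m) + 2 Re(c̄ W(η_m ⋆ h̃)) + |c|² Re Q(h)`
  have hineq : ∀ (m : ℕ) (c : ℂ), 0 ≤ (weilQuadratic (η m)).re +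
      2 * (conj c * weilFunctional (weilConv (η m) (weilReflect h))).re +
        Complex.normSq c * (weilQuadratic h).re := by
    intro m c
    have hsup : tsupport (η m + fun x ↦ c * h x) ⊆ Icc (-a) a :=
      (tsupport_add _ _).trans (union_subset (hηs m) (tsupport_mul_subset_right.trans hhs))
    have hp := hpos (η m + fun x ↦ c * h x) ((hηt m).add (hh.const_mul c)) hsup
    rw [weilQuadratic_add_const_mul (hηt m) hh c, weilForm_conj_symm (hηt m) hh] at hp
    have e : (c * conj (weilFunctional (weilConv (η m) (weilReflect h)))).re =
        (conj c * weilFunctional (weilConv (η m) (weilReflect h))).re := by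
      rw [← Complex.conj_re (c * conj _), map_mul, Complex.conj_conj]
    simp only [add_re, e, Complex.re_ofReal_mul] at hp
    linarith
  -- pass to the limit `m → ∞`
  have hQη : Tendsto (fun m ↦ (weilQuadratic (η m)).re) atTop (𝓝 0) := by
    have h := tendsto_weilFinitePrimeQuadratic_of_energy ha hξ₀ hηD hηE (primeCutoff a)
    rw [h0] at h
    exact h.congr fun m ↦ weilFinitePrimeQuadratic_eq_re_weilQuadratic_of_isWeilTest (hηt m) (hηs m)
  have hlim : ∀ c : ℂ, 0 ≤ 2 * (conj c * Z).re + Complex.normSq c * (weilQuadratic h).re := by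
    intro c
    have h2 : Tendsto (fun m ↦ 2 * (conj c * weilFunctional (weilConv (η m) (weilReflect h))).re)
        atTop (𝓝 (2 * (conj c * Z).re)) :=
      ((Complex.continuous_re.tendsto _).comp (hB.const_mul (conj c))).const_mul 2
    have ht := (hQη.add h2).add (tendsto_const_nhds (x := Complex.normSq c * (weilQuadratic h).re))
    rw [zero_add] at ht
    exact ge_of_tendsto' ht fun m ↦ hineq m c
  -- `Z = 0`: test with `c = −t Z`, `t > 0` small
  by_contra hZ
  have hN : 0 < Complex.normSq Z := Complex.normSq_pos.2 hZ
  set q : ℝ := (weilQuadratic h).re with hq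
  set t : ℝ := 1 / (|q| + 1) with ht
  have htpos : 0 < t := by positivity
  have htq : t * q < 2 := by
    have h1 : t * q ≤ t * |q| := mul_le_mul_of_nonneg_left (le_abs_self q) htpos.le
    have h2 : t * |q| < 1 := by
      rw [ht, div_mul_eq_mul_div, one_mul, div_lt_one (by positivity)]
      linarith
    linarith
  have h := hlim (-(t : ℂ) * Z)
  have e1 : (conj (-(t : ℂ) * Z) * Z).re = -t * Complex.normSq Z := by
    rw [map_mul, map_neg, Complex.conj_ofReal, mul_assoc, ← Complex.normSq_eq_conj_mul_self]
    simp
  have e2 : Complex.normSq (-(t : ℂ) * Z) = t ^ 2 * Complex.normSq Z := by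
    rw [Complex.normSq_mul, Complex.normSq_neg, Complex.normSq_ofReal]; ring
  rw [e1, e2] at h
  have : 0 ≤ t * Complex.normSq Z * (t * q - 2) := by nlinarith
  have hneg : t * Complex.normSq Z * (t * q - 2) < 0 :=
    mul_neg_of_pos_of_neg (mul_pos htpos hN) (by linarith)
  linarith

end Radical

end YoshidaCompletedForm

/-! ## Main statements -/

section Main

open YoshidaCompletedForm

variable {a : ℝ}

/-- **Under ¬RH the completed Weil form degenerates at the threshold** (Yoshida 1992, Thm. 2, the
`⟸` half, for `k = ℚ`, in the `L²`-extension language of Connes–Consani 2023 §2): if the Riemann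
hypothesis fails then, with `a₀ = weilPositivityThreshold ≥ (log 3)/2` (Yoshida's Prop. 6), the extended
form `QW_λ` (`λ = e^{a₀}`) is `≥ 0` on every square-integrable function supported in `[−a₀, a₀]` AND has
a null vector of norm one in its form domain `K̂(a₀) = Dom(QW_λ)`: it is positive semi-definite and
DEGENERATE there. Yoshida (p. 321): "These facts immediately imply that `( , )|W(a)` degenerates at
`a = a₀`"; here by the compact-embedding road (negative unit vectors past `a₀` have bounded energy, a
subsequence converges in `L²`, the limit lives on `[−a₀, a₀]`, lower semicontinuity gives `E ≤ 0`,
positivity at `a₀` gives `E ≥ 0`). [cite: Yoshida1992HermitianForms, Thm. 2 (p. 321) with Prop. 6 (p. 320); ConnesConsani2023, Prop. 2.1 and Lemma 2.2, pp. 103–105] -/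
theorem completedWeilForm_degenerate_of_not_riemannHypothesis (hRH : ¬ RiemannHypothesis) :
    Real.log 3 / 2 ≤ weilPositivityThreshold ∧
    (∀ ξ : ℝ → ℂ, MemLp ξ 2 volume →
        Function.support ξ ⊆ Icc (-weilPositivityThreshold) weilPositivityThreshold →
        0 ≤ semilocalWeilForm weilPositivityThreshold ξ) ∧
    ∃ ξ₀ : ℝ → ℂ, ξ₀ ∈ formDomain weilPositivityThreshold ∧ ∫ x, ‖ξ₀ x‖ ^ 2 = 1 ∧
        semilocalWeilForm weilPositivityThreshold ξ₀ = 0 := by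
  set a₀ := weilPositivityThreshold with ha₀def
  obtain ⟨hlow, hpos, -⟩ := Yoshida1992_prop6 hRH
  have ha₀ : 0 < a₀ := lt_of_lt_of_le (by positivity) hlow
  have hWa₀ : WeilPositivityOn a₀ := hpos a₀ le_rfl
  refine ⟨hlow, fun ξ hξm hξs ↦ semilocalWeilForm_nonneg_of_weilPositivityOn ha₀ hWa₀ hξm hξs, ?_⟩
  set a₁ : ℝ := a₀ + 1 with ha₁def
  have ha₁ : 0 < a₁ := by positivity
  set N₁ : ℕ := primeCutoff a₁ with hN₁
  obtain ⟨M, u, hu⟩ := exists_negative_unit_seq_of_not_riemannHypothesis hRH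
  have hb₁ : ∀ n : ℕ, a₀ + 1 / ((n : ℝ) + 1) ≤ a₁ := fun n ↦ by
    have : 1 / ((n : ℝ) + 1) ≤ 1 := by
      rw [div_le_one (by positivity)]; linarith [(Nat.cast_nonneg n : (0 : ℝ) ≤ n)]
    simp only [ha₁def]; linarith
  have huD : ∀ n, u n ∈ formDomain a₁ := fun n ↦
    mem_formDomain_of_isWeilTest (hu n).1 ((hu n).2.1.trans (Icc_subset_Icc
      (by linarith [hb₁ n]) (hb₁ n)))
  -- Rellich: a subsequence converges in `L²`
  obtain ⟨ξ, hξm, hξs, φ, hφ, hconv⟩ := exists_subseq_tendsto_of_energy_le ha₁ huD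
    (fun n ↦ (hu n).2.2.1.le) (fun n ↦ (hu n).2.2.2.2)
  have huφ : ∀ j, MemLp (u (φ j)) 2 volume ∧ Function.support (u (φ j)) ⊆ Icc (-a₁) a₁ :=
    fun j ↦ ⟨(huD (φ j)).1, (huD (φ j)).2.1⟩
  -- `∫|ξ|² = 1`
  have hξ1 : ∫ x, ‖ξ x‖ ^ 2 = 1 := by
    have h := tendsto_integral_norm_sq_of_tendsto_sub hξm (fun j ↦ (huφ j).1) hconv
    have e : (fun j ↦ ∫ x, ‖u (φ j) x‖ ^ 2) = fun _ ↦ (1 : ℝ) := funext fun j ↦ (hu (φ j)).2.2.1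
    rw [e] at h
    exact tendsto_nhds_unique h tendsto_const_nhds
  -- `ξ` vanishes a.e. off `[−a₀, a₀]`
  have hT : ∀ m : ℕ, ∀ᵐ x ∂volume, a₀ + 1 / ((m : ℝ) + 1) < |x| → ξ x = 0 := by
    intro m
    set T : Set ℝ := {x | a₀ + 1 / ((m : ℝ) + 1) < |x|} with hT
    have hTm : MeasurableSet T :=
      measurableSet_lt (measurable_const : Measurable fun _ : ℝ ↦ a₀ + 1 / ((m : ℝ) + 1))
        (measurable_id.abs : Measurable fun x : ℝ ↦ |x|)
    have hgi : Integrable (fun x ↦ ‖ξ x‖ ^ 2) := integrable_norm_sq_of_memLp hξm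
    -- `∫_T |ξ|² ≤ ∫ |u_{φ j} − ξ|²` for `j ≥ m`
    have hle : ∀ j, m ≤ j → ∫ x in T, ‖ξ x‖ ^ 2 ≤ ∫ x, ‖u (φ j) x - ξ x‖ ^ 2 := by
      intro j hj
      have hφj : m ≤ φ j := hj.trans (hφ.id_le j)
      have hzero : ∀ x ∈ T, u (φ j) x = 0 := by
        intro x hx
        refine Function.notMem_support.1 fun h ↦ ?_
        have h1 := (subset_tsupport _ |>.trans (hu (φ j)).2.1) h
        simp only [mem_Icc] at h1
        have h2 : 1 / ((φ j : ℝ) + 1) ≤ 1 / ((m : ℝ) + 1) :=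
          one_div_le_one_div_of_le (by positivity) (by exact_mod_cast Nat.add_le_add_right hφj 1)
        have h3 : |x| ≤ a₀ + 1 / ((φ j : ℝ) + 1) := abs_le.2 ⟨h1.1, h1.2⟩
        exact absurd hx (not_lt.2 (h3.trans (by linarith)))
      have e : ∫ x in T, ‖ξ x‖ ^ 2 = ∫ x in T, ‖u (φ j) x - ξ x‖ ^ 2 :=
        setIntegral_congr_fun hTm fun x hx ↦ by rw [hzero x hx, zero_sub, norm_neg]
      rw [e]
      exact setIntegral_le_integral (integrable_norm_sq_of_memLp ((huφ j).1.sub hξm))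
        (Eventually.of_forall fun x ↦ by positivity)
    have hT0 : ∫ x in T, ‖ξ x‖ ^ 2 = 0 := by
      refine le_antisymm ?_ (setIntegral_nonneg hTm fun x _ ↦ by positivity)
      exact ge_of_tendsto hconv (Filter.eventually_atTop.2 ⟨m, hle⟩)
    have hae : (fun x ↦ ‖ξ x‖ ^ 2) =ᵐ[volume.restrict T] 0 :=
      (integral_eq_zero_iff_of_nonneg (fun x ↦ by positivity) hgi.integrableOn.integrable).1 hT0
    have hae' : ∀ᵐ x ∂volume, x ∈ T → ‖ξ x‖ ^ 2 = 0 := (ae_restrict_iff' hTm).1 hae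
    filter_upwards [hae'] with x hx hxT
    have := hx hxT
    simpa using this
  have hξae : ∀ᵐ x ∂volume, x ∉ Icc (-a₀) a₀ → ξ x = 0 := by
    rw [← ae_all_iff] at hT
    filter_upwards [hT] with x hx hxI
    have hxa : a₀ < |x| := by
      simp only [mem_Icc, not_and_or, not_le] at hxI
      rcases hxI with h | h
      · have : x < 0 := by linarith
        rw [abs_of_neg this]; linarith
      · exact lt_of_lt_of_le h (le_abs_self x)
    obtain ⟨m, hm⟩ := exists_nat_one_div_lt (by linarith : 0 < |x| - a₀)
    exact hx m (by linarith)
  -- the window-`a₀` representative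
  set ξ₀ : ℝ → ℂ := (Icc (-a₀) a₀).indicator ξ with hξ₀def
  have hξ₀ae : ξ₀ =ᵐ[volume] ξ := by
    filter_upwards [hξae] with x hx
    by_cases h : x ∈ Icc (-a₀) a₀
    · simp [hξ₀def, h]
    · simp [hξ₀def, h, hx h]
  have hξ₀m : MemLp ξ₀ 2 volume := hξm.indicator measurableSet_Icc
  have hξ₀s : Function.support ξ₀ ⊆ Icc (-a₀) a₀ := Set.support_indicator_subset
  have hξ₀s' : Function.support ξ₀ ⊆ Icc (-a₁) a₁ :=
    hξ₀s.trans (Icc_subset_Icc (by linarith) (by linarith))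
  have hconv₀ : Tendsto (fun j ↦ ∫ x, ‖u (φ j) x - ξ₀ x‖ ^ 2) atTop (𝓝 0) := by
    refine hconv.congr fun j ↦ integral_congr_ae ?_
    filter_upwards [hξ₀ae] with x hx
    rw [hx]
  have hξ₀1 : ∫ x, ‖ξ₀ x‖ ^ 2 = 1 := by
    rw [← hξ1]
    refine integral_congr_ae ?_
    filter_upwards [hξ₀ae] with x hx
    rw [hx]
  -- finite energy: lower semicontinuity of `‖·̂‖₁²` under `L¹` convergence
  have hL1 : Tendsto (fun j ↦ ∫ x, ‖u (φ j) x - ξ₀ x‖) atTop (𝓝 0) := by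
    have hcs : ∀ j, (∫ x, ‖u (φ j) x - ξ₀ x‖) ^ 2 ≤ 2 * a₁ * ∫ x, ‖u (φ j) x - ξ₀ x‖ ^ 2 :=
      fun j ↦ sq_integral_norm_le ((huφ j).1.sub hξ₀m)
        (support_sub_subset_window (huφ j).2 hξ₀s') ha₁
    have h2 : Tendsto (fun j ↦ Real.sqrt (2 * a₁ * ∫ x, ‖u (φ j) x - ξ₀ x‖ ^ 2)) atTop (𝓝 0) := by
      have := (hconv₀.const_mul (2 * a₁)).sqrt
      simpa using this
    refine tendsto_of_tendsto_of_tendsto_of_le_of_le tendsto_const_nhds h2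
      (fun j ↦ integral_nonneg fun _ ↦ norm_nonneg _) fun j ↦ ?_
    exact (le_abs_self _).trans (Real.abs_le_sqrt (hcs j))
  have hξ₀E : logSobolevEnergy ξ₀ < ∞ := by
    have h := logSobolevEnergy_le_liminf_of_tendsto_integral_norm hξ₀m hξ₀s' huφ hL1
    refine lt_of_le_of_lt (h.trans ?_) (ENNReal.ofReal_lt_top (r := M))
    refine Filter.liminf_le_of_frequently_le (Frequently.of_forall fun j ↦ ?_)
    have hfin : logSobolevEnergy (u (φ j)) < ∞ := (huD (φ j)).2.2
    rw [← ENNReal.ofReal_toReal hfin.ne]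
    exact ENNReal.ofReal_le_ofReal (hu (φ j)).2.2.2.2
  have hξ₀D : ξ₀ ∈ formDomain a₀ := ⟨hξ₀m, hξ₀s, hξ₀E⟩
  have hξ₀D₁ : ξ₀ ∈ formDomain a₁ := ⟨hξ₀m, hξ₀s', hξ₀E⟩
  -- `E_{N₁}(ξ₀) ≤ 0` by lower semicontinuity
  have hle0 : weilFinitePrimeQuadratic N₁ ξ₀ ≤ 0 := by
    have h := semilocalWeilForm_le_liminf ha₁ hξ₀m hξ₀s' huφ hconv₀
    rw [semilocalWeilForm_of_mem_formDomain hξ₀D₁] at h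
    have h2 : liminf (fun j ↦ semilocalWeilForm a₁ (u (φ j))) atTop ≤ 0 := by
      refine Filter.liminf_le_of_frequently_le (Frequently.of_forall fun j ↦ ?_)
      rw [semilocalWeilForm_of_mem_formDomain (huD (φ j))]
      exact_mod_cast (hu (φ j)).2.2.2.1.le
    exact_mod_cast h.trans h2
  -- `E_{N₁}(ξ₀) ≥ 0` by Weil positivity AT the threshold, passed to the completion
  have hge0 : 0 ≤ weilFinitePrimeQuadratic N₁ ξ₀ :=
    weilFinitePrimeQuadratic_nonneg_of_weilPositivityOn ha₀ hWa₀ hξ₀D (primeCutoff_mono (by linarith))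
  refine ⟨ξ₀, hξ₀D, hξ₀1, ?_⟩
  rw [semilocalWeilForm_of_mem_formDomain hξ₀D,
    weilFinitePrimeQuadratic_eq_of_le ha₀ hξ₀D le_rfl (primeCutoff_mono (by linarith) : _ ≤ N₁),
    le_antisymm hle0 hge0, EReal.coe_zero]

/-- The unconditional dichotomy: either RH, or at a finite threshold `a₀ ≥ (log 3)/2` the completed Weil
form is positive semi-definite and degenerate. [cite: Yoshida1992HermitianForms, Thm. 2 (p. 321) with Prop. 6 (p. 320)] -/
theorem riemannHypothesis_or_completedWeilForm_degenerate :
    RiemannHypothesis ∨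
      ∃ a₀ : ℝ, Real.log 3 / 2 ≤ a₀ ∧
        (∀ ξ : ℝ → ℂ, MemLp ξ 2 volume → Function.support ξ ⊆ Icc (-a₀) a₀ →
          0 ≤ semilocalWeilForm a₀ ξ) ∧
        ∃ ξ₀ : ℝ → ℂ, ξ₀ ∈ formDomain a₀ ∧ ∫ x, ‖ξ₀ x‖ ^ 2 = 1 ∧ semilocalWeilForm a₀ ξ₀ = 0 := by
  by_cases hRH : RiemannHypothesis
  · exact Or.inl hRH
  · exact Or.inr ⟨weilPositivityThreshold, completedWeilForm_degenerate_of_not_riemannHypothesis hRH⟩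

/-- **Yoshida's Theorem 2, `⟸` (k = ℚ), kernel form**: if for every window `a > 0` the completed Weil
form, whenever it is positive semi-definite on the window, has only the trivial null vector in its form
domain `K̂(a)` (non-degeneracy), then the Riemann hypothesis holds. ("The Riemann hypothesis for `ζ_k(s)`
holds if and only if the hermitian form `( , )` on `K̂(a)` is non-degenerate for every `a > 0`", p. 321 —
the hypothesis here is weaker than non-degeneracy for all `a`.) RH-FREE as an implication; nothing is
asserted about which alternative holds. [cite: Yoshida1992HermitianForms, Thm. 2 (p. 321)] -/
theorem riemannHypothesis_of_forall_completedWeilForm_nondegenerate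
    (h : ∀ a : ℝ, 0 < a →
      (∀ ξ : ℝ → ℂ, MemLp ξ 2 volume → Function.support ξ ⊆ Icc (-a) a → 0 ≤ semilocalWeilForm a ξ) →
      ∀ ξ : ℝ → ℂ, ξ ∈ formDomain a → semilocalWeilForm a ξ = 0 → ξ =ᵐ[volume] 0) :
    RiemannHypothesis := by
  by_contra hRH
  obtain ⟨hlow, hpsd, ξ₀, hξ₀D, hξ₀1, hξ₀0⟩ := completedWeilForm_degenerate_of_not_riemannHypothesis hRH
  have ha₀ : 0 < weilPositivityThreshold := lt_of_lt_of_le (by positivity) hlow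
  have hae := h _ ha₀ hpsd ξ₀ hξ₀D hξ₀0
  have h0 : ∫ x, ‖ξ₀ x‖ ^ 2 = 0 := by
    rw [integral_congr_ae (show (fun x ↦ ‖ξ₀ x‖ ^ 2) =ᵐ[volume] fun _ ↦ (0 : ℝ) from by
      filter_upwards [hae] with x hx; simp [hx])]
    simp
  rw [h0] at hξ₀1
  exact zero_ne_one hξ₀1

/-- **Weil positivity on a window ⟺ positivity of the `L²`-extended form on the window**
(`a > 0`). [cite: ConnesConsani2023, Prop. 2.1 (the L²-extension of QW_λ), p. 103; Yoshida1992HermitianForms, §0 p. 282] -/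
theorem weilPositivityOn_iff_semilocalWeilForm_nonneg (ha : 0 < a) :
    WeilPositivityOn a ↔
      ∀ ξ : ℝ → ℂ, MemLp ξ 2 volume → Function.support ξ ⊆ Icc (-a) a → 0 ≤ semilocalWeilForm a ξ :=
  ⟨fun h _ hξm hξs ↦ semilocalWeilForm_nonneg_of_weilPositivityOn ha h hξm hξs,
    weilPositivityOn_of_semilocalWeilForm_nonneg⟩

/-- **Under RH the completed Weil form is positive semi-definite and non-degenerate on every window**
(Yoshida 1992, Thm. 2 `⟹`, `k = ℚ`): for every `a > 0`, `QW_λ ≥ 0` on the window-supported `L²`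
functions and its only null vector in `formDomain a = K̂(a)` is `0`. RH-CONSEQUENCE (explicit
`RiemannHypothesis →` binder). [cite: Yoshida1992HermitianForms, Thm. 2 (p. 321), proof pp. 321–322] -/
theorem completedWeilForm_posDef_of_riemannHypothesis (hRH : RiemannHypothesis) {a : ℝ} (ha : 0 < a) :
    (∀ ξ : ℝ → ℂ, MemLp ξ 2 volume → Function.support ξ ⊆ Icc (-a) a → 0 ≤ semilocalWeilForm a ξ) ∧
      ∀ ξ : ℝ → ℂ, ξ ∈ formDomain a → semilocalWeilForm a ξ = 0 → ξ =ᵐ[volume] 0 :=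
  ⟨fun _ hξm hξs ↦ semilocalWeilForm_nonneg_of_weilPositivityOn ha
      (riemannHypothesis_iff_forall_weilPositivityOn.1 hRH a ha) hξm hξs,
    fun _ hξ h0 ↦ ae_eq_zero_of_semilocalWeilForm_eq_zero hRH ha hξ h0⟩

/-- RH-EQUIVALENT·DERIVED (line 1): **Yoshida 1992, Theorem 2, for `k = ℚ`, as a kernel equivalence in
the completed-space language** — the Riemann hypothesis holds if and only if, for every window `a > 0`
on which the `L²`-extended Weil form `QW_λ` (`λ = e^a`) is positive semi-definite, the form is
NON-DEGENERATE on its form domain `K̂(a)` (no non-zero null vector). `⟹`: positive definiteness under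
RH (zero side + Lemma 2.1-type uniqueness); `⟸`: degeneracy at Yoshida's threshold under `¬RH`
(`completedWeilForm_degenerate_of_not_riemannHypothesis`). An equivalence PROVED AS AN EQUIVALENCE; it
asserts neither side. WHAT THIS IS NOT: not evidence for RH or against it; nothing here bears on the
truth of RH. [cite: Yoshida1992HermitianForms, Thm. 2 (p. 321)] -/
theorem riemannHypothesis_iff_forall_completedWeilForm_nondegenerate :
    RiemannHypothesis ↔
      ∀ a : ℝ, 0 < a →
        (∀ ξ : ℝ → ℂ, MemLp ξ 2 volume → Function.support ξ ⊆ Icc (-a) a →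
            0 ≤ semilocalWeilForm a ξ) →
        ∀ ξ : ℝ → ℂ, ξ ∈ formDomain a → semilocalWeilForm a ξ = 0 → ξ =ᵐ[volume] 0 :=
  ⟨fun hRH _ ha _ ↦ (completedWeilForm_posDef_of_riemannHypothesis hRH ha).2,
    riemannHypothesis_of_forall_completedWeilForm_nondegenerate⟩

/-- RH-EQUIVALENT·DERIVED (line 1): the positive-definite form of the same criterion — RH holds iff for
every window `a > 0` the completed Weil form is positive semi-definite AND has no non-zero null vector
in `K̂(a)`. An equivalence proved as an equivalence; asserts neither side.
[cite: Yoshida1992HermitianForms, Thm. 2 (p. 321) with §0 p. 282] -/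
theorem riemannHypothesis_iff_forall_completedWeilForm_posDef :
    RiemannHypothesis ↔
      ∀ a : ℝ, 0 < a →
        (∀ ξ : ℝ → ℂ, MemLp ξ 2 volume → Function.support ξ ⊆ Icc (-a) a →
            0 ≤ semilocalWeilForm a ξ) ∧
        ∀ ξ : ℝ → ℂ, ξ ∈ formDomain a → semilocalWeilForm a ξ = 0 → ξ =ᵐ[volume] 0 :=
  ⟨fun hRH _ ha ↦ completedWeilForm_posDef_of_riemannHypothesis hRH ha,
    fun h ↦ riemannHypothesis_of_forall_completedWeilForm_nondegenerate fun a ha _ ↦ (h a ha).2⟩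

/-- **Ground states of the semilocal Weil form exist** (RH-free; Bombieri 2000 Thm. 3 for one window, in
the completed-space language): for every window `a > 0` the ground energy
`ε(a) = inf {Re Q(g) : g test, supp g ⊆ [−a, a], ‖g‖₂ = 1}` — an infimum over test functions, where it
need not be attained — IS attained in the completed space: there is a unit vector
`ξ ∈ Dom(QW_λ) = formDomain a` with `QW_λ(ξ) = ε(a)`, and `QW_λ(ξ) ≤ QW_λ(η)` for every unit vector `η`
of `L²([−a, a])` (off the domain the form is `+∞`).  Compact-embedding road: minimising sequence,
coercivity, the Rellich lemma `exists_subseq_tendsto_of_energy_le`, lower semicontinuity.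
[cite: Bombieri2000Weil, §4 Thm. 3 (p. 196); ConnesConsani2023, Prop. 2.1 and Cor. 2.4 (the lower bound of QW_λ / smallest eigenvalue), pp. 102–106] -/
theorem exists_semilocalWeilForm_ground_state (ha : 0 < a) :
    ∃ ξ ∈ formDomain a, ∫ t, ‖ξ t‖ ^ 2 = (1 : ℝ) ∧
      semilocalWeilForm a ξ = ((weilGroundEnergy a : ℝ) : EReal) ∧
      ∀ η : ℝ → ℂ, MemLp η 2 volume → Function.support η ⊆ Icc (-a) a →
        ∫ t, ‖η t‖ ^ 2 = (1 : ℝ) → semilocalWeilForm a ξ ≤ semilocalWeilForm a η := by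
  obtain ⟨ξ, hξD, hξ1, hE⟩ := exists_ground_state ha
  refine ⟨ξ, hξD, hξ1, ?_, fun η hηm hηs hηn ↦ ?_⟩
  · rw [semilocalWeilForm_of_mem_formDomain hξD, hE, formLowerBound_eq_weilGroundEnergy ha]
  · by_cases hηE : logSobolevEnergy η < ∞
    · have hηD : η ∈ formDomain a := ⟨hηm, hηs, hηE⟩
      rw [semilocalWeilForm_of_mem_formDomain hξD, semilocalWeilForm_of_mem_formDomain hηD, hE,
        EReal.coe_le_coe_iff]
      exact formLowerBound_le hηD hηn (bddBelow_formDomain_values ha)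
    · rw [semilocalWeilForm_of_not_lt_top hηE]; exact le_top

/-- The ground energy of a window is a value of the completed form at a unit vector of the form domain
(`ε(a) = min`, not only `inf`, on `Dom(QW_λ)`). [cite: ConnesConsani2023, Cor. 2.4, p. 106; Bombieri2000Weil, §4 Thm. 3 (p. 196)] -/
theorem exists_weilFinitePrimeQuadratic_eq_weilGroundEnergy (ha : 0 < a) :
    ∃ ξ ∈ formDomain a, ∫ t, ‖ξ t‖ ^ 2 = (1 : ℝ) ∧
      weilFinitePrimeQuadratic (primeCutoff a) ξ = weilGroundEnergy a := by
  obtain ⟨ξ, hξD, hξ1, hE⟩ := exists_ground_state ha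
  exact ⟨ξ, hξD, hξ1, hE.trans (formLowerBound_eq_weilGroundEnergy ha)⟩

/-- Under `¬ RH`, at Yoshida's threshold `a₀` the ground energy is exactly `0` and it is attained: the
lower bound of `QW_{e^{a₀}}` vanishes (positive semi-definite with a null vector,
`completedWeilForm_degenerate_of_not_riemannHypothesis`). [cite: Yoshida1992HermitianForms, Thm. 2 (p. 321) with Prop. 6 (p. 320)] -/
theorem formLowerBound_threshold_eq_zero_of_not_riemannHypothesis (hRH : ¬ RiemannHypothesis) :
    formLowerBound weilPositivityThreshold = 0 ∧ weilGroundEnergy weilPositivityThreshold = 0 := by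
  obtain ⟨hlow, hpsd, ξ₀, hξ₀D, hξ₀1, hξ₀E⟩ := completedWeilForm_degenerate_of_not_riemannHypothesis hRH
  have ha₀ : 0 < weilPositivityThreshold := lt_of_lt_of_le (by positivity) hlow
  have hE0 : weilFinitePrimeQuadratic (primeCutoff weilPositivityThreshold) ξ₀ = 0 := by
    rw [semilocalWeilForm_of_mem_formDomain hξ₀D] at hξ₀E
    exact_mod_cast hξ₀E
  have h0 : formLowerBound weilPositivityThreshold = 0 := by
    refine le_antisymm ?_ (le_csInf (formDomain_values_nonempty ha₀) ?_)
    · rw [← hE0]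
      exact formLowerBound_le hξ₀D hξ₀1 (bddBelow_formDomain_values ha₀)
    · rintro x ⟨ξ, hξ, -, rfl⟩
      have h := hpsd ξ hξ.1 hξ.2.1
      rw [semilocalWeilForm_of_mem_formDomain hξ] at h
      exact_mod_cast h
  exact ⟨h0, (formLowerBound_eq_weilGroundEnergy ha₀).symm.trans h0⟩

/-- RH-CONSEQUENCE: **under RH the bottom of the spectrum of `QW_λ` is STRICTLY positive on every
window**, `0 < formLowerBound a` for all `a > 0`: the ground state of `exists_ground_state` is a unit vector
of `Dom(QW_λ)` with `E = formLowerBound a ≥ 0` (Weil positivity under RH, passed to the completion), and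
`formLowerBound a = 0` would make it a non-zero null vector, which RH forbids
(`completedWeilForm_posDef_of_riemannHypothesis`).  By `formLowerBound_eq_weilGroundEnergy` this is the
completed-space form of `0 < ε(a)`, which the summit tree proves by a completion-free road
(`Summit.RiemannHypothesis.RiemannHypothesis.Theorems.weilGroundEnergy_pos_of_riemannHypothesis`, file
`SoloInformedNonDegenerate.lean`: spectral ceiling + Selberg nodes + interpolation); here it is attainment
(Bombieri's Thm. 3) + positive definiteness (Yoshida's Thm. 2 `⟹`).
[cite: Yoshida1992HermitianForms, Thm. 2 (p. 321: under RH the form on K̂(a) is non-degenerate); Bombieri2000Weil, §4 Thm. 3 (p. 196)] -/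
theorem formLowerBound_pos_of_riemannHypothesis (hRH : RiemannHypothesis) (ha : 0 < a) :
    0 < formLowerBound a := by
  obtain ⟨ξ, hξD, hξ1, hE⟩ := exists_ground_state ha
  obtain ⟨hpsd, hdef⟩ := completedWeilForm_posDef_of_riemannHypothesis hRH ha
  have h0 : 0 ≤ formLowerBound a := by
    have h := hpsd ξ hξD.1 hξD.2.1
    rw [semilocalWeilForm_of_mem_formDomain hξD, hE] at h
    exact_mod_cast h
  rcases h0.eq_or_lt with h | h
  · exfalso
    have hnull : semilocalWeilForm a ξ = 0 := by
      rw [semilocalWeilForm_of_mem_formDomain hξD, hE, ← h, EReal.coe_zero]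
    have hae := hdef ξ hξD hnull
    have h2 : ∫ x, ‖ξ x‖ ^ 2 = 0 := by
      rw [integral_congr_ae (show (fun x ↦ ‖ξ x‖ ^ 2) =ᵐ[volume] fun _ ↦ (0 : ℝ) from by
        filter_upwards [hae] with x hx; simp [hx])]
      simp
    rw [h2] at hξ1
    exact zero_ne_one hξ1
  · exact h

/-- RH-EQUIVALENT·DERIVED (line 1): **RH ⟺ the bottom of the spectrum of `QW_λ` is strictly positive on
every window** (`∀ a > 0, 0 < formLowerBound a`) — the completed-space, attained-minimum form of
"RH ⟺ `∀ a > 0, 0 < ε(a)`" (summit tree, `riemannHypothesis_iff_forall_weilGroundEnergy_pos` of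
`SoloInformedNonDegenerate.lean`), sharpening `riemannHypothesis_iff_forall_weilPositivityOn` (`0 ≤ ε(a)`).
An equivalence proved as an equivalence; asserts neither side. [cite: Yoshida1992HermitianForms, Thm. 2 (p. 321) with §0 p. 281 (Weil's criterion on windows); Bombieri2000Weil, §4 Thm. 3] -/
theorem riemannHypothesis_iff_forall_formLowerBound_pos :
    RiemannHypothesis ↔ ∀ a : ℝ, 0 < a → 0 < formLowerBound a :=
  ⟨fun hRH _ ha ↦ formLowerBound_pos_of_riemannHypothesis hRH ha,
    fun h ↦ riemannHypothesis_iff_forall_weilPositivityOn.2 fun a ha ↦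
      (weilGroundEnergy_nonneg_iff_holds ha).1
        ((h a ha).le.trans (formLowerBound_eq_weilGroundEnergy ha).le)⟩

/-- The bottom of the spectrum of `QW_λ` is `≥ 0` iff Weil positivity holds on the window (`a > 0`).
[cite: ConnesConsani2023, Prop. 2.1, p. 103; Bombieri2000Weil, §4 (ε(a) ≥ 0 ⟺ positivity on the window)] -/
theorem formLowerBound_nonneg_iff_weilPositivityOn (ha : 0 < a) :
    0 ≤ formLowerBound a ↔ WeilPositivityOn a := by
  rw [formLowerBound_eq_weilGroundEnergy ha]
  exact weilGroundEnergy_nonneg_iff_holds ha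

/-- Under `¬ RH`, beyond Yoshida's threshold every window carries a GROUND STATE OF NEGATIVE ENERGY in the
completed space: for `a > a₀` there is a unit vector `ξ ∈ Dom(QW_λ)` with `E(ξ) = ε(a) < 0`.
[cite: Yoshida1992HermitianForms, Prop. 6 (2) (p. 320); Bombieri2000Weil, §4 Thm. 3 (p. 196)] -/
theorem exists_negative_ground_state_of_threshold_lt (hRH : ¬ RiemannHypothesis)
    (ha : weilPositivityThreshold < a) :
    ∃ ξ ∈ formDomain a, ∫ t, ‖ξ t‖ ^ 2 = (1 : ℝ) ∧
      weilFinitePrimeQuadratic (primeCutoff a) ξ = weilGroundEnergy a ∧ weilGroundEnergy a < 0 := by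
  obtain ⟨hlow, -, hfail⟩ := Yoshida1992_prop6 hRH
  have ha0 : 0 < a := lt_trans (lt_of_lt_of_le (by positivity) hlow) ha
  obtain ⟨ξ, hξD, hξ1, hE⟩ := exists_weilFinitePrimeQuadratic_eq_weilGroundEnergy ha0
  refine ⟨ξ, hξD, hξ1, hE, lt_of_not_ge fun h ↦ hfail a ha ?_⟩
  exact (weilGroundEnergy_nonneg_iff_holds ha0).1 h

/-- **Under `¬RH`: a non-trivial null relation among the values `ξ̂₀(ρ)` at the zeros, annihilating
the whole window** (the completed-space form of Suzuki 2023 Thm. 6.1 / Yoshida's degeneracy): there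
are `a₀ ≥ (log 3)/2` (`= weilPositivityThreshold`) and a unit vector `ξ₀ ∈ Dom(QW_{e^{a₀}})` such that
`ξ̂₀` does NOT vanish at every non-trivial zero, yet `Σ_ρ m(ρ) ξ̂₀(ρ) conj ĥ(1 − ρ̄) = 0` (absolutely
convergent) for EVERY test function `h` supported in `[−a₀, a₀]`. [cite: Yoshida1992HermitianForms, Thm. 2 (p. 321); Suzuki2023, Thm. 6.1 and §6.2 (p. 16)] -/
theorem exists_zeroSide_null_relation_of_not_riemannHypothesis (hRH : ¬ RiemannHypothesis) :
    ∃ ξ₀ : ℝ → ℂ, ξ₀ ∈ formDomain weilPositivityThreshold ∧ ∫ x, ‖ξ₀ x‖ ^ 2 = 1 ∧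
      (∃ ρ ∈ ZetaZeros.riemannZetaNontrivialZeros, weilMellin ξ₀ ρ ≠ 0) ∧
      ∀ h : ℝ → ℂ, IsWeilTest h →
        tsupport h ⊆ Icc (-weilPositivityThreshold) weilPositivityThreshold →
        HasSum (fun ρ : ZetaZeros.riemannZetaNontrivialZeros ↦
          (riemannZetaZeroOrder (ρ : ℂ) : ℂ) *
            (weilMellin ξ₀ ρ * conj (weilMellin h (1 - conj (ρ : ℂ))))) 0 := by
  obtain ⟨hlow, hpsd, ξ₀, hξ₀D, hξ₀1, hξ₀E⟩ := completedWeilForm_degenerate_of_not_riemannHypothesis hRH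
  have ha₀ : 0 < weilPositivityThreshold := lt_of_lt_of_le (by positivity) hlow
  have hW : WeilPositivityOn weilPositivityThreshold := (Yoshida1992_prop6 hRH).2.1 _ le_rfl
  have hE0 : weilFinitePrimeQuadratic (primeCutoff weilPositivityThreshold) ξ₀ = 0 := by
    rw [semilocalWeilForm_of_mem_formDomain hξ₀D] at hξ₀E
    exact_mod_cast hξ₀E
  refine ⟨ξ₀, hξ₀D, hξ₀1, ?_, fun h hh hhs ↦ hasSum_zeroSide_radical ha₀ hW hξ₀D hE0 hh hhs⟩
  by_contra hall
  push Not at hall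
  have hae := ae_eq_zero_of_weilMellin_eq_zero_on_zeros ha₀ hξ₀D.1 hξ₀D.2.1 hall
  have h0 : ∫ x, ‖ξ₀ x‖ ^ 2 = 0 := by
    rw [integral_congr_ae (show (fun x ↦ ‖ξ₀ x‖ ^ 2) =ᵐ[volume] fun _ ↦ (0 : ℝ) from by
      filter_upwards [hae] with x hx; simp [hx])]
    simp
  rw [h0] at hξ₀1
  exact zero_ne_one hξ₀1

end Main

end Literature.NumberTheory.LFunctions

end
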